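import Literature.MathematicalPhysics.QuantumFieldTheory.Balaban1983to89.Node00.OpsYRecordV5

/-!
# `Balaban1983to89.Node00.OpsYSectEElim` — T. Bałaban, *Propagators for lattice gauge theories in a background field*, Commun. Math. Phys. **99** (1985)
# 389–434 [Balaban1985BackgroundPropagators], Sect. E (3.157)–(3.158) p. 428 (with [5] = *Averaging operations for lattice gauge theories*, CMP **98**
# (1985) 17–51 [Balaban1985Averaging], (125) p. 36, and [4] = *Propagators … II*, CMP **96** (1984) 223–250 [Balaban1984PropagatorsII], (2.154)–(2.156)
# pp. 249–250): THE LETTERS `Λ̃`, `C(V)`, `C(V)*` OF (3.157) — THE AXIAL-GAUGE BOND ELIMINATION — AS GENUINE FUNCTIONS OF THE BACKGROUND ON NODE 00's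
# CARRIER; THE v6 INSTANCE OF RECORD OF NODE 00's OPERATOR LAYER WITH SEVEN Sect. E LETTERS GENUINE

Print, p. 428: *«Let us take the subspace of functions B defined on [bonds of T_η], satisfying the conditions: B = 0 on Λᶜ (Dirichlet boundary conditions),
B = 0 on ⋃_{y∈Λ′} Δ_k(y) (the axial gauge in all big blocks of Λ), Q(V)B = 0 on Λ′.  An arbitrary function B on this subspace can be represented with
the help of a function B̃ defined on Λ̃ = Λ ∖ {⋃_{y∈Λ′} Δ_k(y) ∪ ⋃_{c∈Λ′} B(c) ∩ c}.  Here B(c) ∩ c consists of the exactly one bond b₀ of B(c) contained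
in c.  The values of B at these bonds b₀ can be determined by the equalities (Q(V)B)(c) = 0, c ∈ Λ′, and we define the linear operator C by B = CB̃
(3.157).  It is an identity operator on almost all bonds, except the bonds b₀ where (CB)(b₀) is equal to a solution of the equation (QB)(c) = 0.»* and
(3.158) `C^{(k)}(Λ; U) = C C̃^{(k)}(Λ; U) C*`.  The one-step averaging operator `Q(V)` is [5]'s main term (125): *«(Q₀A)_c = Σ_{x∈B(c₋)} L^{−(d+1)}
(R_{0,c₋}A)([x, x(c)])»* ([5]'s lattice is `d`-dimensional; here `d + 1`, so the normalisation is `L^{−(d+2)}`), `R_{0,c₋}` transporting along the block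
contours `Γ_{c₋,x}` and `[x, x(c)]` the straight contour of `L` unit bonds from `x` in the direction of `c` ((52)–(53), (58): products of `R(V₀(b)) = Ad`).
`Node00.OpsYSectELetters` ∕ `Node00.OpsYRecordV5` made `μ`, `D̄`, `μ*`, `D̄*` of (3.185) genuine and left `Λ̃`, `C`, `C*` (with `⟨D̃⁽²⁾, J⟩`, `G̃₂`)
parameters of the Sect. E letter record `SectELettersY` (`Node00.OpsYSectE` §3).  THIS FILE constructs `Λ̃`, `C(V)`, `C(V)*` on NODE 00's bond carrier
`IBondY x.toKIdx` over the same averaged-field parameter `𝔳 : AvY 𝔸 x` (unit-bond transports `R(V(b)) = Ad V(b)`, `RUY`; block-contour transports `RVY`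
of `Node00.OpsYSectELetters`), PROVES the three defining properties of print's `C` — identity on `Λ̃`, range inside the constrained subspace, `B = C(P_{Λ̃}B)`
on that subspace — and the adjointness of `C*`, and files the v6 instance of record with the seven letters `Λ̃ ∕ C ∕ C* ∕ μ ∕ D̄ ∕ μ* ∕ D̄*` genuine.

WHAT IS BUILT (member `x : MemberY …`, unit torus `USiteY x = T₁^{(k)}`, unit bonds `UBondY x`, index bonds `IBondY x.toKIdx`).
§1 `CoarseGeometry`: `IsCornerY x y` (the `L`-lattice points `T^{(k+1)}`: `ucorner y = y`); `ublockY x y` (the `L`-block `B(y)` as the fibre of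
   `corner ∘ labK`; `blockOf_eq_of_mem_ublockY`, `goodY_of_mem_ublockY`, `mem_Om_of_mem_ublockY`); `unextY x y μ = y + L·e_μ`; ★ `IsCoarseY x (y, μ)` —
   THE BONDS `c ∈ Λ′` OF `T^{(k+1)}`: `y` a corner with BOTH end blocks `B(c₋)`, `B(c₊)` good (declared dictionary for print's «c ∈ Λ′»); the finite type
   `CBondY x`; ★ `upivU x c = ⟨y + (L−1)e_μ, μ⟩` — THE PIVOT `b₀(c) = B(c) ∩ c` as a unit bond and `pivIY x c` as an index bond (`pivIY_injective`);
   `usegY x z μ` — the straight contour `[z, z + L e_μ]` of `L` unit bonds; ★ `eq_of_upivU_mem_usegY` — THE PIVOT OF `c` IS A SEGMENT BOND ONLY OF THE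
   SEGMENTS OF `c` (print's «exactly one bond b₀»: the system (3.157) is diagonal over `Λ′`); `upivU_ne_of_mem_comb` (pivots are not axial-tree bonds).
§2 `Elim` (parameter `𝔳`): `readUY x B` (a bond function read at unit bonds sourced in `Ω_k^{(k)}`, zero elsewhere; `readUY_single`); `RUY x 𝔳 U b =
   Ad(V(b))`; `qNormY d ℓ = L^{−(d+2)}`; ★★ `Q1Y x 𝔳 U c : (IBondY → 𝔸) →ₗ[ℂ] 𝔸` — THE ONE-STEP AVERAGING (125) OF A BOND FUNCTION AT THE COARSE BOND `c`:
   `L^{−(d+2)} Σ_{z ∈ B(c₋)} R(V(Γ_{c₋,z})) (R_z(V)B)([z, z(c)])`; `KY x 𝔳 U c : Module.End ℂ 𝔸` — THE PIVOT COEFFICIENT `a ↦ (Q(V)(δ_{b₀(c)} ⊗ a))(c)`;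
   `IsAxialY` (bonds of `⋃ Δ_k(y)`), `IsPivY`; ★★ `lamTY x q :↔ q ∈ Λ ∧ q ∉ ⋃Δ_k(y) ∧ q ≠ b₀(c)` — THE LETTER `Λ̃`, `lamTY_inΛ`; ★★★ `elimCY x 𝔳 : IBondOpY 𝔸
   x.toKIdx`, `C(V) = P_{Λ̃} − Σ_{c ∈ Λ′} (δ_{b₀(c)} ⊗ ·) ∘ K_c(V)⁻¹ ∘ Q(V)_c ∘ P_{Λ̃}` — THE LETTER `C` OF (3.157) (`K_c⁻¹ := Ring.inverse`, the genuine
   inverse wherever `K_c(V)` is a unit and `0` otherwise); `elimCY_apply`.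
§3 `Faces`: `inΛY_pivIY` (pivots are bonds over `Λ`: `Λ` is a union of `k`-blocks, `mem_Λ_iff_of_iterBlockOf_eq`); SUPPORT `elimCY_apply_of_isAxialY`
   (axial gauge on the range), `elimCY_apply_of_not_inΛY` (Dirichlet on the range); ★ `elimCY_apply_of_lamTY` — `C` IS THE IDENTITY ON `Λ̃`;
   `elimCY_mul_secY` (`C P_{Λ̃} = C`), `secΛY_mul_elimCY` (`P_Λ C = C`); ★ `Q1Y_single_pivIY_of_ne` ∕ `_self` (the pivot system is diagonal with
   entries `K_c`); ★★ `Q1Y_elimCY (hK : IsUnit K_c)` — THE CONSTRAINTS `(Q(V) C(V) B)(c) = 0` HOLD ON THE RANGE; ★★★ `elimCY_eq_self_of_constraints` —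
   for `B` supported on `Λ̃ ∪ {b₀(c)}` with `(Q(V)B)(c) = 0` on `Λ′` (all `K_c` units), `C(V)B = B`: print's «an arbitrary function B on this subspace
   can be represented … B = CB̃» with `B̃ = P_{Λ̃}B`.  AT `U = 1` (record transports, `V(1) = 1`): ★★ `KY_one` — `K_c(1) = L^{−(d+1)}·id` (exactly `L`
   of the segment bonds of `c` are the pivot: `ofZ_add_eq_upivU_src_iff`, `ofZ_add_mem_ublockY`), `isUnit_KY_one`, hence `Q1Y_elimCY_one` and
   `elimCY_one_eq_self_of_constraints` with NO unit hypothesis ([4]'s flat parametrisation (2.154)–(2.156) on NODE 00's carrier).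
§4 `Transpose` (flat trace pairing `Σ_q τ(B(q)A(q))`, tracial `τ : 𝔸 →ₗ[ℂ] ℂ`): `placeUY` (transpose of `readUY`, `sum_tr_readUY_mul`); `RUTY = RUY⁻¹`
   (`R(V)* = R(V⁻¹)`, `trFormY_RUY` by `B9Eq39Adjoint.trace_R_mul`); `tr_hol_mul` (the transpose of `R(V(Γ))` is its inverse, from `OpsYRecordV5`'s
   `pair_hol_symm_apply`); ★ `Q1TY x 𝔳 U c : 𝔸 →ₗ[ℂ] (IBondY → 𝔸)` — `Q(V)*` at `c` (built from `OpsYRecordV5.trSumT`), ★★ `tr_Q1Y_mul`: `τ((Q(V)B)(c)·v) =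
   Σ_q τ(B(q)·(Q(V)*v)(q))`; `KTY` = `K_c*` (`tr_KY_mul`), `tr_inverse_KY_mul` (`(K_c⁻¹)* = (K_c*)⁻¹`, both units); ★★★ `elimCtY x 𝔳 : IBondOpY 𝔸 x.toKIdx`,
   `C(V)* = P_{Λ̃} − Σ_c P_{Λ̃} Q(V)*_c (K_c*)⁻¹ ev_{b₀(c)}` — THE LETTER `C*`; ★★★ `sum_tr_elimCY_mul (hK) (hKT)`: `Σ_q τ((C B)(q)·A(q)) = Σ_q τ(B(q)·(C*A)(q))`
   — `C*` IS THE TRANSPOSE OF `C`; `secY_mul_elimCtY` (`P_{Λ̃} C* = C*`), `elimCtY_mul_secΛY` (`C* P_Λ = C*`).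
§5 `LettersTC`: ★★ `sectELettersYOfRecordTC x 𝔳 𝔢₀ := sectELettersYOfRecordT x 𝔳 {𝔢₀ with LamT := lamTY x, elimC := elimCY x 𝔳, elimCt := elimCtY x 𝔳}`
   — the Sect. E record with SEVEN letters genuine (`⟨D̃⁽²⁾, J⟩`, `G̃₂` stay `𝔢₀`'s: `_params`); `elimCΛY_sectELettersYOfRecordTC` ∕ `elimCtΛY_…`:
   `Node00.OpsYSectE`'s dressed `P_Λ C P_{Λ̃}`, `P_{Λ̃} C* P_Λ` ARE `C(V)`, `C(V)*` at this record; `CkY_sectELettersYOfRecordTC`: (3.158) unfolds to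
   `C(V) · C̃^{(k)}(Λ; U) · C(V)*`; `localOuterY_ofRecordTC` (= `OpsYRecordV5.localOuterY_ofRecordT`, the outer letters being unchanged).
§6 `RecordV6` (record fibre `M_N(ℂ)`): ★★ `sectEYOfRecordV6 N θ M⋆ 𝔢₀ x := sectELettersYOfRecordTC x (avYOfRecord x) (𝔢₀ x)`
   (`sectEYOfRecordV6_eq_sectEYOfRecordV5`: it IS `sectEYOfRecordV5` of `{𝔢₀ with Λ̃, C, C*}`, so every v5 face applies); ★★★ `opsYOfRecordV6E 𝔯 𝔢₀ 𝔴 𝔈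
   := opsYOfRecordV4E … 𝔯 (sectEYOfRecordV6 … 𝔢₀) 𝔴 𝔈` — THE v6 INSTANCE OF RECORD (same binder shape as v4∕v5; `opsYOfRecordV6E_eq`, `_letters`);
   `CkY_sectEYOfRecordV6`; `localOuterY_sectEYOfRecordV6` (NO residual hypothesis); `sum_trace_elimC_elimCt_sectEYOfRecordV6` (+ the `μ∕μ*`, `D̄∕D̄*`
   ones); ★★★ `t315_opsYOfRecordV6E_of_3185` ∕ `_on` — row 24 of the N06 certificate at the v6 instance through the (3.185) slot, three displayed
   conjuncts `givenBy3185Y ∧ hasRWExpCY ∧ DecayMidY` (resp. `DecayMidOnY`), `LocalOuterY` discharged as in v5.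

HONEST MARGINS. (i) COARSE BONDS: print's `c ∈ Λ′` is read as «`c₋` an `L`-corner with both end blocks `B(c₋)`, `B(c₊)` good» (`IsCoarseY`) — the bonds
of `T^{(k+1)}` joining two good blocks; a bond leaving `Λ′` carries no constraint here.  (ii) INVERTIBILITY of the pivot coefficients `K_c(V)` is NOT
claimed for `U ≠ 1`: `C`, `C*` use `Ring.inverse`, the range∕parametrisation∕adjointness faces carry `IsUnit (KY …)` (and `IsUnit (KTY …)`) hypotheses,
discharged here at `U = 1` only (`KY_one`: `K_c(1) = L^{−(d+1)} id`); for small fields `K_c(V) = L^{−(d+1)}(id + O(|V − 1|))` is print's regime, not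
proved here.  (iii) TRANSPOSES are for the FLAT trace pairing `Σ_q τ(B(q)A(q))` on NODE 00's bond carrier with `R(V)* = R(V⁻¹)` for a tracial `τ`
(convention (v) of `Node00.OpsYSectELetters`, margin (i) of `Node00.OpsYRecordV5`); print's `*` (inner products (3.16) with level weights) differs by
the diagonal weights recorded there.  (iv) `V = 𝔳 U` is the lineage's averaged-field DICTIONARY (`avYOfRecord` at the record: `G`-valued, `= 1` at
`U = 1`); `Q(V)` is [5]'s MAIN TERM (125) of the linear form (124) — the `O(L²α₀)` corrections of (124) are not part of this letter (print itself
denotes the main term by `Q(V₀)`, p. 36).  (v) `⟨D̃⁽²⁾, J⟩` ((3.156), [5]'s second-order term) and `G̃₂` ((3.184)–(3.186)) remain PARAMETERS of the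
record; nothing of (3.159)–(3.184) is claimed; the (3.185) identity, the expansion slot and the middle-factor decay stay displayed in row 24.
Net new unproved facts: 0.
-/

noncomputable section

namespace Literature.MathematicalPhysics.QuantumFieldTheory.Balaban1983to89.Node00

open B9Eq3169Mu
open B9Eq39Adjoint (R R_inv_R R_R_inv R_one R_smul trace_R_mul)
open B9PinMembersKLevelV1 (MemberY)
open B9PinGeometryKLevelV1 (inΛY kLab)
open B6GlobalChartV1 (PV toBox domT)
open B6Elimination (corner mem_block corner_apply corner_le lt_corner_add mem_block_corner corner_corner
  corner_eq_of_mem_block mem_block_corner_iff)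
open B6BondElimination (unitVec unitVec_apply add_unitVec_apply mem_contour)
open B9Eq3169Comb (comb mem_comb_iff corner_of_mem_comb)
open B6MultiLevelBoxOperator (bigSide bigSide_eq)
open B9BackgroundsKLevelV1 (blk_toBox_eq_mul)
open B6GlobalChartV1 (blk_toBox)
open B6Ineq2142KLevelV1 (lvl base baseSite iterBlockOf_baseSite)
open B5Eq118OneStroke (iterBlockOf)
open B9Thm315WholeSectERep (LocalOuterY)

variable {d ℓ : ℕ} {hd : 1 ≤ d + 1} {hL : Odd (ℓ + 1) ∧ 1 < ℓ + 1} {b₀ b₁ : ℝ} {Mstar : ℕ}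

/-! ## §1 Coarse-bond geometry on the unit torus `T₁^{(k)}`: `L`-lattice corners, label blocks, the bonds `c ∈ Λ′` of `T^{(k+1)}`,
the pivot `b₀(c) = B(c) ∩ c`, the straight segments `[x, x(c)]` -/

section CoarseGeometry

variable (x : MemberY d ℓ hd hL b₀ b₁ Mstar)

/-- **`L`-LATTICE POINTS** of the unit torus (the sites of `T^{(k+1)} ⊂ T₁^{(k)}` in [5]'s corner convention): `y` is the corner of its `L`-block.
[cite: Balaban1985Averaging, (1.5) p.18 + p.24, dictionary] -/
def IsCornerY (y : USiteY x) : Prop := ucorner x y = y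

/-- corners in the chart: `corner(labK y) = labK y`. [cite: Balaban1985Averaging, p.24, bookkeeping] -/
theorem isCornerY_iff (y : USiteY x) : IsCornerY x y ↔ corner (ℓ + 1) (labK x y) = labK x y := by
  constructor
  · intro h
    have e := congrArg (labK x) h
    rwa [labK_ucorner] at e
  · intro h
    show ofZ x (corner (ℓ + 1) (labK x y)) = y
    rw [h, ofZ_labK]

/-- the block corner is a corner. [cite: Balaban1985Averaging, p.24, bookkeeping] -/
theorem isCornerY_ucorner (y : USiteY x) : IsCornerY x (ucorner x y) := by
  rw [isCornerY_iff, labK_ucorner, corner_corner ell_succ_pos]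

/-- **THE `L`-BLOCK `B(y)`** of the unit torus through `y`, in the label chart (the fibre of `corner ∘ labK`).
[cite: Balaban1984PropagatorsI, (1.6) p.18; Balaban1985Averaging, p.24, dictionary] -/
def ublockY (y : USiteY x) : Finset (USiteY x) := Finset.univ.filter fun z => corner (ℓ + 1) (labK x z) = corner (ℓ + 1) (labK x y)

/-- membership in `B(y)`. [cite: Balaban1984PropagatorsI, (1.6) p.18, bookkeeping] -/
theorem mem_ublockY {y z : USiteY x} : z ∈ ublockY x y ↔ corner (ℓ + 1) (labK x z) = corner (ℓ + 1) (labK x y) := by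
  simp [ublockY]

/-- `y ∈ B(y)`. [cite: Balaban1984PropagatorsI, (1.6) p.18, bookkeeping] -/
theorem mem_ublockY_self (y : USiteY x) : y ∈ ublockY x y := (mem_ublockY x).2 rfl

/-- the label of a block point lies in the label block. [cite: Balaban1984PropagatorsI, (1.6) p.18, bookkeeping] -/
theorem labK_mem_block_of_mem_ublockY {y z : USiteY x} (h : z ∈ ublockY x y) :
    labK x z ∈ B6Elimination.block (ℓ + 1) (corner (ℓ + 1) (labK x y)) :=
  (mem_block_corner_iff ell_succ_pos).2 ((mem_ublockY x).1 h)

/-- same label block, same block point of `T^{(k+1)}`. [cite: Balaban1984PropagatorsI, (1.6) p.18, bookkeeping] -/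
theorem blockOf_eq_of_mem_ublockY {y z : USiteY x} (h : z ∈ ublockY x y) : blockOf z = blockOf y := by
  have e := blockOf_ofZ_eq x (labK_mem_block_of_mem_ublockY x h)
  rwa [ofZ_labK] at e

/-- `Λ′` is a union of blocks. [cite: Balaban1985BackgroundPropagators, p.427, bookkeeping] -/
theorem goodY_of_mem_ublockY {y z : USiteY x} (hy : GoodY x y) (h : z ∈ ublockY x y) : GoodY x z :=
  (goodY_iff_of_blockOf_eq x (blockOf_eq_of_mem_ublockY x h)).2 hy

/-- a point of a good block lies in `Ω_k^{(k)}`. [cite: Balaban1984PropagatorsII, (2.3) p.224, bookkeeping] -/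
theorem mem_Om_of_mem_ublockY {y z : USiteY x} (hy : GoodY x y) (h : z ∈ ublockY x y) : z ∈ (domT x.hN x.D x.hk).Om x.k :=
  mem_Om_of_good x hy (blockOf_eq_of_mem_ublockY x h)

/-- **a label at offset `s·e_μ`, `0 ≤ s ≤ ℓ = L − 1`, from a corner stays in the corner's block** (the unit sites of the straight contour `c`
inside `B(c₋)`). [cite: Balaban1984PropagatorsI, (1.6) p.18; Balaban1985BackgroundPropagators, p.428 («B(c) ∩ c»), bookkeeping] -/
theorem add_smul_unitVec_mem_block {y : USiteY x} (hy : IsCornerY x y) (μ : Fin (d + 1)) {s : ℤ} (h0 : 0 ≤ s) (hs : s ≤ ℓ) :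
    labK x y + s • unitVec μ ∈ B6Elimination.block (ℓ + 1) (corner (ℓ + 1) (labK x y)) := by
  rw [(isCornerY_iff x y).1 hy, mem_block]
  intro i
  rw [Pi.add_apply, Pi.smul_apply, unitVec_apply, smul_eq_mul]
  by_cases hi : i = μ
  · rw [if_pos hi, mul_one]; constructor <;> push_cast <;> omega
  · rw [if_neg hi, mul_zero, add_zero]; constructor <;> push_cast <;> omega

/-- **THE NEXT CORNER** `y + L·e_μ` (the end point `c₊` of the coarse bond from `c₋ = y` in direction `μ`). [cite: Balaban1985BackgroundPropagators, (3.157) p.428, dictionary] -/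
def unextY (y : USiteY x) (μ : Fin (d + 1)) : USiteY x := ofZ x (labK x y + (((ℓ + 1 : ℕ) : ℤ)) • unitVec μ)

/-- **THE POSITIVELY ORIENTED BONDS `c ∈ Λ′` OF `T^{(k+1)}`** as a predicate on (corner, direction): `c₋ = y` is an `L`-lattice point and both end
blocks `B(c₋)`, `B(c₊)` lie in `Λ′` (the index set of the constraints (3.157) `Q(U_k)B̃′ = 0` that are solved for the pivots).
[cite: Balaban1985BackgroundPropagators, (3.157) p.428 («c an arbitrary bond of Λ′»)] -/
def IsCoarseY (c : USiteY x × Fin (d + 1)) : Prop := IsCornerY x c.1 ∧ GoodY x c.1 ∧ GoodY x (unextY x c.1 c.2)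

open Classical in
/-- the finite set of the bonds `c ∈ Λ′`. [cite: Balaban1985BackgroundPropagators, (3.157) p.428, dictionary] -/
def coarseY : Finset (USiteY x × Fin (d + 1)) := Finset.univ.filter fun c => IsCoarseY x c

/-- membership in `coarseY`. [cite: Balaban1985BackgroundPropagators, (3.157) p.428, bookkeeping] -/
theorem mem_coarseY {c : USiteY x × Fin (d + 1)} : c ∈ coarseY x ↔ IsCoarseY x c := by
  classical
  simp [coarseY]

/-- the type of the bonds `c ∈ Λ′` (the index type of the pivots `b₀(c)` and of the constraints (3.157)). [cite: Balaban1985BackgroundPropagators, (3.157) p.428, dictionary] -/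
abbrev CBondY : Type := ↥(coarseY x)

/-- a bond `c ∈ Λ′` satisfies the predicate. [cite: Balaban1985BackgroundPropagators, (3.157) p.428, bookkeeping] -/
theorem isCoarseY_of (c : CBondY x) : IsCoarseY x c.1 := (mem_coarseY x).1 c.2

/-- **THE PIVOT UNIT BOND `b₀(c) = B(c) ∩ c`**: the last unit bond `⟨y + (L−1)e_μ, y + L·e_μ⟩` of the straight contour `c` from `y = c₋` (print:
*"B(c) ∩ c consists of the exactly one bond b₀ of B(c) contained in c"*; B6's `pivSite`). [cite: Balaban1985BackgroundPropagators, p.428; Balaban1984PropagatorsII, (2.154) p.249] -/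
def upivU (c : USiteY x × Fin (d + 1)) : UBondY x := ⟨ofZ x (labK x c.1 + (ℓ : ℤ) • unitVec c.2), c.2⟩

/-- the pivot's source lies in `B(c₋)`. [cite: Balaban1985BackgroundPropagators, p.428 («b₋ ∈ B(c₋)»), bookkeeping] -/
theorem upivU_src_mem_ublockY {c : USiteY x × Fin (d + 1)} (hc : IsCornerY x c.1) : (upivU x c).src ∈ ublockY x c.1 := by
  have hmem := add_smul_unitVec_mem_block x hc c.2 (s := (ℓ : ℤ)) (by positivity) le_rfl
  rw [mem_ublockY]
  show corner (ℓ + 1) (labK x (ofZ x (labK x c.1 + (ℓ : ℤ) • unitVec c.2))) = _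
  rw [labK_ofZ x (inBox_of_mem_block x hmem), corner_eq_of_mem_block ell_succ_pos hmem]

/-- the label of the pivot's source. [cite: Balaban1985BackgroundPropagators, p.428, bookkeeping] -/
theorem labK_upivU_src {c : USiteY x × Fin (d + 1)} (hc : IsCornerY x c.1) : labK x (upivU x c).src = labK x c.1 + (ℓ : ℤ) • unitVec c.2 :=
  labK_ofZ x (inBox_of_mem_block x (add_smul_unitVec_mem_block x hc c.2 (s := (ℓ : ℤ)) (by positivity) le_rfl))

/-- the pivot's source lies in `Ω_k^{(k)}` for `c ∈ Λ′`. [cite: Balaban1984PropagatorsII, (2.3) p.224, bookkeeping] -/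
theorem upivU_src_mem_Om {c : USiteY x × Fin (d + 1)} (hc : IsCoarseY x c) : (upivU x c).src ∈ (domT x.hN x.D x.hk).Om x.k :=
  mem_Om_of_mem_ublockY x hc.2.1 (upivU_src_mem_ublockY x hc.1)

/-- ★ **THE PIVOT INDEX BOND `b₀(c)`** of `c ∈ Λ′` on NODE 00's bond carrier. [cite: Balaban1985BackgroundPropagators, p.428 («the bonds b₀»)] -/
def pivIY (c : CBondY x) : IBondY x.toKIdx := idxOfU x (upivU x c.1) (upivU_src_mem_Om x (isCoarseY_of x c))

/-- `idxOfU` is injective in the unit bond. [cite: Balaban1984PropagatorsII, (2.3) p.224, bookkeeping] -/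
theorem idxOfU_inj {b b' : UBondY x} {h : b.src ∈ (domT x.hN x.D x.hk).Om x.k} {h' : b'.src ∈ (domT x.hN x.D x.hk).Om x.k}
    (e : idxOfU x b h = idxOfU x b' h') : b = b' := by
  have e1 := congrArg Subtype.val e
  exact eq_of_heq (Sigma.mk.inj_iff.1 e1).2

/-- the unit source ∕ target of `idxOfU b` determine `b`'s data. [cite: Balaban1984PropagatorsII, (2.3) p.224, bookkeeping] -/
theorem ubondOfIdx_idxOfU (b : UBondY x) (h : b.src ∈ (domT x.hN x.D x.hk).Om x.k) : ubondOfIdx x (idxOfU x b h) = b := by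
  cases b
  simp only [ubondOfIdx, usrc_idxOfU]
  rfl

/-- corners with equal labels-plus-offset are equal: the pivot determines the coarse bond among corners. [cite: Balaban1985BackgroundPropagators, p.428, bookkeeping] -/
theorem upivU_inj {c c' : USiteY x × Fin (d + 1)} (hc : IsCornerY x c.1) (hc' : IsCornerY x c'.1) (e : upivU x c = upivU x c') : c = c' := by
  have hμ : c.2 = c'.2 := congrArg PBond.dir e
  have hs : labK x (upivU x c).src = labK x (upivU x c').src := by rw [e]
  rw [labK_upivU_src x hc, labK_upivU_src x hc', hμ] at hs
  have h1 : labK x c.1 = labK x c'.1 := add_right_cancel hs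
  refine Prod.ext ?_ hμ
  rw [← ofZ_labK x c.1, h1, ofZ_labK]

/-- ★ `c ↦ b₀(c)` is injective on `Λ′`. [cite: Balaban1985BackgroundPropagators, p.428 («exactly one bond b₀»), bookkeeping] -/
theorem pivIY_injective : Function.Injective (pivIY x) := fun c c' e =>
  Subtype.ext (upivU_inj x (isCoarseY_of x c).1 (isCoarseY_of x c').1 (idxOfU_inj x e))

/-- **THE STRAIGHT SEGMENT `[z, z(c)]`** of the contour `Γ_{c,z}` ([5] (14)): the `L` unit bonds `⟨z + s·e_μ, z + (s+1)·e_μ⟩`, `s = 0, …, L − 1`, from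
`z ∈ B(c₋)` to `z(c) = z + L·e_μ ∈ B(c₊)`, listed from `z`. [cite: Balaban1985Averaging, (14) p.19, (125) p.36] -/
def usegY (z : USiteY x) (μ : Fin (d + 1)) : List (UBondY x) :=
  (List.range (ℓ + 1)).map fun s : ℕ => ⟨ofZ x (labK x z + ((s : ℕ) : ℤ) • unitVec μ), μ⟩

/-- membership in a segment. [cite: Balaban1985Averaging, (14) p.19, bookkeeping] -/
theorem mem_usegY {z : USiteY x} {μ : Fin (d + 1)} {b : UBondY x} :
    b ∈ usegY x z μ ↔ ∃ s : ℕ, s < ℓ + 1 ∧ (⟨ofZ x (labK x z + ((s : ℕ) : ℤ) • unitVec μ), μ⟩ : UBondY x) = b := by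
  simp [usegY, List.mem_range]

/-- a segment has `L` bonds. [cite: Balaban1985Averaging, (14) p.19, bookkeeping] -/
theorem length_usegY (z : USiteY x) (μ : Fin (d + 1)) : (usegY x z μ).length = ℓ + 1 := by
  simp [usegY]

/-- chart algebra: `ofZ (u + v) = ofZ u + ofZ v` coordinatewise. [cite: Balaban1984PropagatorsII, (2.1) p.224, bookkeeping] -/
theorem ofZ_apply (u : Fin (d + 1) → ℤ) (i : Fin (d + 1)) : ofZ x u i = ((u i : ℤ) : ZMod ((PV d ℓ x.m x.K hd hL).sitesPerDir x.k)) := rfl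

/-- ★ **THE PIVOT IS READ BY EXACTLY ONE COARSE BOND**: if `b₀(c)` is a bond of a segment `[z, z + L·e_μ]` with `z ∈ B(y)`, `y` a corner, then
`c = (y, μ)` — the unit bonds of the segments from `B(c₋)` in direction `μ` are sourced in `B(c₋) ∪ B(c₊)` minus the pivot row of `B(c₊)`.
[cite: Balaban1985BackgroundPropagators, p.428 («B(c) ∩ c consists of the exactly one bond b₀»); Balaban1984PropagatorsII, (2.154) p.249] -/
theorem eq_of_upivU_mem_usegY {c : USiteY x × Fin (d + 1)} (hc : IsCornerY x c.1) {y : USiteY x} (hy : IsCornerY x y) {z : USiteY x}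
    (hz : z ∈ ublockY x y) {μ : Fin (d + 1)} (h : upivU x c ∈ usegY x z μ) : c = (y, μ) := by
  obtain ⟨s, hs, e⟩ := (mem_usegY x).1 h
  have hμ : μ = c.2 := congrArg PBond.dir e
  have hsrc : ofZ x (labK x z + (s : ℤ) • unitVec μ) = ofZ x (labK x c.1 + (ℓ : ℤ) • unitVec c.2) := congrArg PBond.src e
  have hz' : z = ofZ x (labK x c.1 + ((ℓ : ℤ) - s) • unitVec μ) := by
    have e2 : ofZ x (labK x z) = ofZ x (labK x c.1 + ((ℓ : ℤ) - s) • unitVec μ) := by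
      funext i
      have ei := congrFun hsrc i
      rw [← hμ] at ei
      simp only [ofZ_apply, Pi.add_apply, Pi.smul_apply, unitVec_apply, smul_eq_mul, Int.cast_add, Int.cast_mul, Int.cast_sub] at ei ⊢
      linear_combination ei
    rwa [ofZ_labK] at e2
  have hmem : labK x c.1 + ((ℓ : ℤ) - s) • unitVec μ ∈ B6Elimination.block (ℓ + 1) (corner (ℓ + 1) (labK x c.1)) :=
    add_smul_unitVec_mem_block x hc μ (by omega) (by omega)
  have hlab : labK x z = labK x c.1 + ((ℓ : ℤ) - s) • unitVec μ := by rw [hz', labK_ofZ x (inBox_of_mem_block x hmem)]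
  have hcz : corner (ℓ + 1) (labK x z) = labK x c.1 := by
    rw [hlab, corner_eq_of_mem_block ell_succ_pos hmem, (isCornerY_iff x _).1 hc]
  have hcy : corner (ℓ + 1) (labK x z) = labK x y := by rw [(mem_ublockY x).1 hz, (isCornerY_iff x _).1 hy]
  have h1 : c.1 = y := by rw [← ofZ_labK x c.1, ← hcz, hcy, ofZ_labK]
  exact Prod.ext h1 hμ.symm

/-- ★ **THE PIVOT IS NOT A TREE BOND**: `b₀(c)` lies on no comb `Γ_{ȳ,y}` (its `μ`-coordinate offset is `L − 1`, a comb bond in direction `μ` has offset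
`< L − 1`; B6's `not_isTree_of_piv`). [cite: Balaban1984PropagatorsII, (2.154) p.249; Balaban1985Averaging, p.24] -/
theorem upivU_ne_of_mem_comb {c : USiteY x × Fin (d + 1)} (hc : IsCornerY x c.1) {y : USiteY x} {b : (Fin (d + 1) → ℤ) × Fin (d + 1)}
    (hb : b ∈ comb (ℓ + 1) (labK x y)) : (⟨ofZ x b.1, b.2⟩ : UBondY x) ≠ upivU x c := by
  intro e
  have hμ : b.2 = c.2 := congrArg PBond.dir e
  have hbox := inBox_of_mem_block x (mem_block_of_mem_comb x y hb)
  have hmem := add_smul_unitVec_mem_block x hc c.2 (s := (ℓ : ℤ)) (by positivity) le_rfl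
  have hs : labK x (ofZ x b.1) = labK x (upivU x c).src := by rw [← e]
  rw [labK_ofZ x hbox, labK_upivU_src x hc] at hs
  -- the comb bond in direction `b.2 = c.2` has `b.1 (b.2) < (labK y) (b.2) ≤ corner + ℓ`, the pivot has offset `ℓ`
  have hcon := (mem_comb_iff ell_succ_pos (labK x y) b).1 hb
  obtain ⟨hw, -, -, h3⟩ := mem_contour.1 hcon
  have hcb : corner (ℓ + 1) b.1 = corner (ℓ + 1) (labK x y) := corner_eq_of_mem_block ell_succ_pos hw
  have hcc : corner (ℓ + 1) b.1 = labK x c.1 := by rw [hs, corner_eq_of_mem_block ell_succ_pos hmem, (isCornerY_iff x _).1 hc]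
  have hy2 : labK x y b.2 < corner (ℓ + 1) (labK x y) b.2 + ((ℓ + 1 : ℕ) : ℤ) :=
    ((mem_block.1 (mem_block_corner (ell_succ_pos (ℓ := ℓ)) (labK x y))) b.2).2
  have e3 : b.1 b.2 = labK x c.1 b.2 + ℓ := by
    have := congrFun hs b.2
    rw [Pi.add_apply, Pi.smul_apply, unitVec_apply, hμ, if_pos rfl, smul_eq_mul, mul_one] at this
    rw [← hμ] at this
    exact this
  rw [← hcb, hcc] at hy2
  push_cast at hy2
  omega

end CoarseGeometry

/-! ## §2 `Q(V)` ((125) of [5]) on NODE 00's bond carrier, the pivot coefficient `K_c`, the variables `Λ̃` and THE LETTER `C` of (3.157)–(3.158) -/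

section Elim

variable {𝔸 : Type} [NormedRing 𝔸] [NormedAlgebra ℂ 𝔸] [CompleteSpace 𝔸]
variable (x : MemberY d ℓ hd hL b₀ b₁ Mstar)

/-- **READING a bond function of NODE 00's carrier on the UNIT bonds** of `T₁^{(k)}` (zero on unit bonds not sourced in `Ω_k^{(k)}`, which carry no
top-level index bond by the source rule). [cite: Balaban1984PropagatorsII, (2.3) p.224; Balaban1985BackgroundPropagators, p.427, dictionary] -/
def readUY (B : IBondY x.toKIdx → 𝔸) : UBondY x → 𝔸 := fun b =>
  if h : b.src ∈ (domT x.hN x.D x.hk).Om x.k then B (idxOfU x b h) else 0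

omit [NormedAlgebra ℂ 𝔸] [CompleteSpace 𝔸] in
/-- the reading at a unit bond sourced in `Ω_k^{(k)}`. [cite: Balaban1984PropagatorsII, (2.3) p.224, bookkeeping] -/
theorem readUY_apply_of_mem (B : IBondY x.toKIdx → 𝔸) {b : UBondY x} (h : b.src ∈ (domT x.hN x.D x.hk).Om x.k) :
    readUY x B b = B (idxOfU x b h) := by
  unfold readUY; rw [dif_pos h]

omit [NormedAlgebra ℂ 𝔸] [CompleteSpace 𝔸] in
/-- the reading off `Ω_k^{(k)}` is `0`. [cite: Balaban1984PropagatorsII, (2.3) p.224, bookkeeping] -/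
theorem readUY_apply_of_not_mem (B : IBondY x.toKIdx → 𝔸) {b : UBondY x} (h : b.src ∉ (domT x.hN x.D x.hk).Om x.k) : readUY x B b = 0 := by
  unfold readUY; rw [dif_neg h]

omit [NormedAlgebra ℂ 𝔸] [CompleteSpace 𝔸] in
/-- the reading is additive. [cite: Balaban1985BackgroundPropagators, (3.157) p.428, bookkeeping] -/
theorem readUY_add (B B' : IBondY x.toKIdx → 𝔸) : readUY x (B + B') = readUY x B + readUY x B' := by
  funext b
  by_cases h : b.src ∈ (domT x.hN x.D x.hk).Om x.k
  · simp only [Pi.add_apply, readUY_apply_of_mem x _ h]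
  · simp only [Pi.add_apply, readUY_apply_of_not_mem x _ h, add_zero]

omit [CompleteSpace 𝔸] in
/-- the reading is homogeneous. [cite: Balaban1985BackgroundPropagators, (3.157) p.428, bookkeeping] -/
theorem readUY_smul (c : ℂ) (B : IBondY x.toKIdx → 𝔸) : readUY x (c • B) = c • readUY x B := by
  funext b
  by_cases h : b.src ∈ (domT x.hN x.D x.hk).Om x.k
  · simp only [Pi.smul_apply, readUY_apply_of_mem x _ h]
  · simp only [Pi.smul_apply, readUY_apply_of_not_mem x _ h, smul_zero]

omit [NormedAlgebra ℂ 𝔸] [CompleteSpace 𝔸] in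
/-- the reading of `0`. [cite: Balaban1985BackgroundPropagators, (3.157) p.428, bookkeeping] -/
theorem readUY_zero : readUY x (0 : IBondY x.toKIdx → 𝔸) = 0 := by
  funext b
  by_cases h : b.src ∈ (domT x.hN x.D x.hk).Om x.k
  · rw [readUY_apply_of_mem x _ h]; rfl
  · rw [readUY_apply_of_not_mem x _ h]; rfl

open Classical in
omit [NormedAlgebra ℂ 𝔸] [CompleteSpace 𝔸] in
/-- **the reading of a bond delta**: `δ_{idxOfU b₀} ⊗ a` reads `a` at `b₀` and `0` elsewhere. [cite: Balaban1985BackgroundPropagators, (3.187) p.432, bookkeeping] -/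
theorem readUY_single (b₀ : UBondY x) (h₀ : b₀.src ∈ (domT x.hN x.D x.hk).Om x.k) (a : 𝔸) (b : UBondY x) :
    readUY x (Pi.single (idxOfU x b₀ h₀) a) b = if b = b₀ then a else 0 := by
  by_cases h : b.src ∈ (domT x.hN x.D x.hk).Om x.k
  · rw [readUY_apply_of_mem x _ h]
    by_cases hb : b = b₀
    · subst hb; rw [if_pos rfl, Pi.single_eq_same]
    · rw [if_neg hb, Pi.single_eq_of_ne]
      exact fun e => hb (idxOfU_inj x e)
  · rw [readUY_apply_of_not_mem x _ h, if_neg]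
    rintro rfl
    exact h h₀

variable (𝔳 : AvY 𝔸 x)

/-- **THE UNIT-BOND TRANSPORTS `R(V(b)) = Ad V(b)`** of the averaged field (the `R(V₀(Γ_{y,b₋}))` of [5] (58) are their products along contours).
[cite: Balaban1985Averaging, (56)–(58) p.27; Balaban1985BackgroundPropagators, p.390] -/
def RUY (U : CfgY 𝔸 x.toKIdx) (b : UBondY x) : 𝔸 ≃ₗ[ℝ] 𝔸 := (adEquivY (𝔳 U b)).restrictScalars ℝ

/-- `RUY` evaluated. [cite: Balaban1985Averaging, (56) p.27, bookkeeping] -/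
@[simp] theorem RUY_apply (U : CfgY 𝔸 x.toKIdx) (b : UBondY x) (v : 𝔸) : RUY x 𝔳 U b v = R (𝔳 U b) v := rfl

/-- `RUY⁻¹` evaluated. [cite: Balaban1985Averaging, (57) p.27, bookkeeping] -/
@[simp] theorem RUY_symm_apply (U : CfgY 𝔸 x.toKIdx) (b : UBondY x) (v : 𝔸) : (RUY x 𝔳 U b).symm v = R (𝔳 U b)⁻¹ v := rfl

/-- the unit-bond transports commute with complex scalars. [cite: Balaban1985Averaging, (56) p.27, bookkeeping] -/
theorem RUY_smulC (U : CfgY 𝔸 x.toKIdx) : ∀ (b : UBondY x) (c : ℂ) (v : 𝔸), RUY x 𝔳 U b (c • v) = c • RUY x 𝔳 U b v :=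
  fun b c v => (adEquivY (𝔳 U b)).map_smul c v

/-- the transports of record agree: `RVY q = RUY (ubondOfIdx q)`. [cite: Balaban1985BackgroundPropagators, (3.168) p.430, bookkeeping] -/
theorem RVY_eq_RUY (U : CfgY 𝔸 x.toKIdx) (q : IBondY x.toKIdx) : RVY x 𝔳 U q = RUY x 𝔳 U (ubondOfIdx x q) := rfl

/-- **THE NORMALISATION `L^{−(d+1)}` OF (125)** in the lattice dimension `d + 1` of NODE 00's torus: `L^{−(d+2)}`. [cite: Balaban1985Averaging, (125) p.36] -/
def qNormY (d ℓ : ℕ) : ℂ := ((((ℓ + 1 : ℕ) : ℂ)) ^ (d + 2))⁻¹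

/-- **(125) AS A FUNCTION**: `Σ_{z ∈ B(c₋)} R(V(Γ_{c₋,z})) (R_z(V)B)([z, z(c)])` — the transported sums of `B` along the straight segments, carried back to
`c₋` along the combs ([5] (14): `Γ_{c,z} = Γ_{c₋,z} ∪ [z, z(c)]`), before normalisation. [cite: Balaban1985Averaging, (125) p.36, (14) p.19, (58) p.27] -/
def q1FunY (U : CfgY 𝔸 x.toKIdx) (B : IBondY x.toKIdx → 𝔸) (c : USiteY x × Fin (d + 1)) : 𝔸 :=
  ∑ z ∈ ublockY x c.1, hol (RVY x 𝔳 U) (uΓ x z) (trSum (RUY x 𝔳 U) (readUY x B) (usegY x z c.2))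

/-- (125) before normalisation is additive in `B`. [cite: Balaban1985Averaging, (125) p.36 («linear form»), bookkeeping] -/
theorem q1FunY_add (U : CfgY 𝔸 x.toKIdx) (B B' : IBondY x.toKIdx → 𝔸) (c : USiteY x × Fin (d + 1)) :
    q1FunY x 𝔳 U (B + B') c = q1FunY x 𝔳 U B c + q1FunY x 𝔳 U B' c := by
  simp only [q1FunY, readUY_add, trSum_add, map_add, Finset.sum_add_distrib]

/-- (125) before normalisation is `ℂ`-homogeneous in `B`. [cite: Balaban1985Averaging, (125) p.36 («linear form»), bookkeeping] -/
theorem q1FunY_smul (U : CfgY 𝔸 x.toKIdx) (a : ℂ) (B : IBondY x.toKIdx → 𝔸) (c : USiteY x × Fin (d + 1)) :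
    q1FunY x 𝔳 U (a • B) c = a • q1FunY x 𝔳 U B c := by
  simp only [q1FunY, readUY_smul, trSum_smulC (RUY x 𝔳 U) (RUY_smulC x 𝔳 U), hol_smulC (RVY x 𝔳 U) (RVY_smulC x 𝔳 U), Finset.smul_sum]

/-- ★★ **`Q(V)` OF (125) AT A COARSE BOND AS A `ℂ`-LINEAR FORM ON NODE 00's BOND CARRIER**: `B ↦ (Q(V)B)(c) = L^{−(d+2)} Σ_{z ∈ B(c₋)} R(V(Γ_{c₋,z}))
(R_z(V)B)([z, z(c)])` (print's main term `Q₀` of the linearisation (124) of the one-step average, transports referred to `c₋`; `V = 𝔳 U`, print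
`V = U_k`). [cite: Balaban1985Averaging, (124)–(125) p.36; Balaban1985BackgroundPropagators, (3.15) p.393, (3.157) p.428] -/
def Q1Y (U : CfgY 𝔸 x.toKIdx) (c : USiteY x × Fin (d + 1)) : (IBondY x.toKIdx → 𝔸) →ₗ[ℂ] 𝔸 where
  toFun B := qNormY d ℓ • q1FunY x 𝔳 U B c
  map_add' B B' := by rw [q1FunY_add, smul_add]
  map_smul' a B := by rw [q1FunY_smul, smul_comm, RingHom.id_apply]

/-- `Q(V)` evaluated. [cite: Balaban1985Averaging, (125) p.36, bookkeeping] -/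
theorem Q1Y_apply (U : CfgY 𝔸 x.toKIdx) (c : USiteY x × Fin (d + 1)) (B : IBondY x.toKIdx → 𝔸) :
    Q1Y x 𝔳 U c B = qNormY d ℓ • ∑ z ∈ ublockY x c.1, hol (RVY x 𝔳 U) (uΓ x z) (trSum (RUY x 𝔳 U) (readUY x B) (usegY x z c.2)) := rfl

open Classical in
/-- ★ **THE PIVOT COEFFICIENT `K_c(V)`** of the equation `(Q(V)B)(c) = 0` in the unknown `B(b₀(c))`: `a ↦ (Q(V)(δ_{b₀(c)} ⊗ a))(c)`, an endomorphism of the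
fibre (`= L^{−(d+1)}·id` at `V = 1`; a sum of `L` transport products in general). [cite: Balaban1985BackgroundPropagators, p.428 («considered as an equation on the variable B(b₀)»)] -/
def KY (U : CfgY 𝔸 x.toKIdx) (c : CBondY x) : Module.End ℂ 𝔸 := Q1Y x 𝔳 U c.1 ∘ₗ LinearMap.single ℂ (fun _ : IBondY x.toKIdx => 𝔸) (pivIY x c)

open Classical in
/-- `K_c` evaluated. [cite: Balaban1985BackgroundPropagators, p.428, bookkeeping] -/
theorem KY_apply (U : CfgY 𝔸 x.toKIdx) (c : CBondY x) (a : 𝔸) : KY x 𝔳 U c a = Q1Y x 𝔳 U c.1 (Pi.single (pivIY x c) a) := rfl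

/-- **THE TREE (AXIAL) BONDS `⋃_{y ∈ Λ′} Δ_k(y)`**: the index bonds on some comb `Γ_{ȳ,y}` of the (3.169) frame (the axial gauge `B = 0 on ⋃ Δ_k(y)`).
[cite: Balaban1985BackgroundPropagators, (3.156)–(3.157) p.428 («B = 0 on ⋃_{y∈Λ′} Δ_k(y)»); Balaban1985Averaging, p.24] -/
def IsAxialY (q : IBondY x.toKIdx) : Prop := ∃ y : USiteY x, q ∈ uΓ x y

/-- **THE PIVOT BONDS `⋃_{c ∈ Λ′} B(c) ∩ c`**. [cite: Balaban1985BackgroundPropagators, p.428] -/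
def IsPivY (q : IBondY x.toKIdx) : Prop := ∃ c : CBondY x, pivIY x c = q

/-- ★★ **THE VARIABLES `Λ̃ = Λ ∖ [⋃_{y ∈ Λ′} Δ_k(y) ∪ ⋃_{c ∈ Λ′} B(c) ∩ c]`** of p. 428 as a predicate on NODE 00's bond carrier: in `Λ`, not a tree bond,
not a pivot. [cite: Balaban1985BackgroundPropagators, p.428 («Λ̃ = Λ ∖ {⋃ Δ_k(y) ∪ ⋃ B(c) ∩ c}»)] -/
def lamTY (q : IBondY x.toKIdx) : Prop := inΛY x q ∧ ¬ IsAxialY x q ∧ ¬ IsPivY x q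

/-- `Λ̃ ⊂ Λ` (the record's `LamT_inΛ`). [cite: Balaban1985BackgroundPropagators, p.428, bookkeeping] -/
theorem lamTY_inΛ : ∀ q : IBondY x.toKIdx, lamTY x q → inΛY x q := fun _ h => h.1

/-- a pivot is not a tree bond. [cite: Balaban1984PropagatorsII, (2.154) p.249; Balaban1985BackgroundPropagators, p.428] -/
theorem not_isAxialY_pivIY (c : CBondY x) : ¬ IsAxialY x (pivIY x c) := by
  classical
  rintro ⟨y, hy⟩
  unfold uΓ at hy
  split_ifs at hy with hg
  · rw [List.mem_pmap] at hy
    obtain ⟨b, hb, e⟩ := hy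
    exact upivU_ne_of_mem_comb x (isCoarseY_of x c).1 hb (idxOfU_inj x e)
  · simp at hy

/-- a pivot is not in `Λ̃`. [cite: Balaban1985BackgroundPropagators, p.428, bookkeeping] -/
theorem not_lamTY_pivIY (c : CBondY x) : ¬ lamTY x (pivIY x c) := fun h => h.2.2 ⟨c, rfl⟩

open Classical in
/-- ★★★ **THE LETTER `C` OF (3.157)–(3.158) AS A FUNCTION OF THE BACKGROUND** — the parametrisation `B = C B̃` of the constrained axial subspace by the
variables `Λ̃`: *"an identity operator on almost all bonds, except the bonds b₀ for which a value (CB)(b₀) is equal to a solution of the equation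
(QB)(c) = 0, considered as an equation on the variable B(b₀)"* — `C(V) = P_{Λ̃} − Σ_{c ∈ Λ′} ι_{b₀(c)} K_c(V)⁻¹ (Q(V) · )(c) P_{Λ̃}` (`Ring.inverse`
for `K_c⁻¹`: the pivot term of `c` is `0` where `K_c(V)` is not a unit). [cite: Balaban1985BackgroundPropagators, (3.157)–(3.158) p.428; Balaban1984PropagatorsII, (2.154)–(2.156) pp.249–250] -/
def elimCY : IBondOpY 𝔸 x.toKIdx := fun U =>
  secY 𝔸 (lamTY x) - ∑ c : CBondY x,
    LinearMap.single ℂ (fun _ : IBondY x.toKIdx => 𝔸) (pivIY x c) ∘ₗ Ring.inverse (KY x 𝔳 U c) ∘ₗ Q1Y x 𝔳 U c.1 ∘ₗ secY 𝔸 (lamTY x)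

open Classical in
/-- **`C` EVALUATED**: `(C B)(q) = (P_{Λ̃}B)(q) − [q = b₀(c)] K_c⁻¹ (Q(V) P_{Λ̃}B)(c)`. [cite: Balaban1985BackgroundPropagators, (3.157) p.428] -/
theorem elimCY_apply (U : CfgY 𝔸 x.toKIdx) (B : IBondY x.toKIdx → 𝔸) (q : IBondY x.toKIdx) :
    elimCY x 𝔳 U B q = secY 𝔸 (lamTY x) B q -
      ∑ c : CBondY x, if q = pivIY x c then Ring.inverse (KY x 𝔳 U c) (Q1Y x 𝔳 U c.1 (secY 𝔸 (lamTY x) B)) else 0 := by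
  simp only [elimCY, LinearMap.sub_apply, LinearMap.coe_sum, Finset.sum_apply, LinearMap.comp_apply, LinearMap.single_apply,
    Pi.sub_apply]
  congr 1
  refine Finset.sum_congr rfl fun c _ => ?_
  by_cases h : q = pivIY x c
  · subst h; rw [if_pos rfl, Pi.single_eq_same]
  · rw [if_neg h, Pi.single_eq_of_ne h]

end Elim

/-! ## §3 Faces of `C`: the pivots lie in `Λ`; support; the constraints on the range; identity on `Λ̃`; `C` inverts the restriction to `Λ̃` -/

section Faces

variable {𝔸 : Type} [NormedRing 𝔸] [NormedAlgebra ℂ 𝔸] [CompleteSpace 𝔸]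
variable (x : MemberY d ℓ hd hL b₀ b₁ Mstar)

/-- **`Λ` IS A UNION OF `k`-BLOCKS** (it is a union of big blocks `hΛblocks`, each a union of `k`-blocks). [cite: Balaban1985BackgroundPropagators, Thm 3.15 p.432 («Λ … a union of big blocks»), bookkeeping] -/
theorem mem_Λ_iff_of_iterBlockOf_eq {z z' : Site (PV d ℓ x.m x.K hd hL) 0} (h : iterBlockOf x.k z = iterBlockOf x.k z') :
    z ∈ x.Λ ↔ z' ∈ x.Λ :=
  x.hΛblocks z z' (by
    rw [bigSide_eq]
    exact blk_toBox_eq_mul x.toKIdx (by rw [blk_toBox x.hN x.hk, blk_toBox x.hN x.hk, h]))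

/-- **an index bond read at a unit bond sourced in a GOOD block lies in `Λ`** (its base point is its source). [cite: Balaban1985BackgroundPropagators, p.427 («Λ′»), Thm 3.15 p.432, bookkeeping] -/
theorem inΛY_idxOfU {b : UBondY x} (hb : GoodY x b.src) (h : b.src ∈ (domT x.hN x.D x.hk).Om x.k) : inΛY x (idxOfU x b h) := by
  refine ⟨rfl, ?_⟩
  obtain ⟨z, hzΛ, hz⟩ := hb b.src rfl
  have h1 : iterBlockOf x.k (baseSite x.hN x.D x.hk (idxOfU x b h)) = b.src := by
    have e := iterBlockOf_baseSite x.hN x.D x.hk (idxOfU x b h)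
    have hc : (idxOfU x b h).1.2.src ∈ (domT x.hN x.D x.hk).Om (lvl x.hN x.D x.hk (idxOfU x b h)) := h
    unfold base at e
    rw [if_pos hc] at e
    exact e
  exact (mem_Λ_iff_of_iterBlockOf_eq x (hz.trans h1.symm)).1 hzΛ

/-- ★ **THE PIVOTS LIE IN `Λ`**. [cite: Balaban1985BackgroundPropagators, p.428 («Λ̃ = Λ ∖ {… ⋃ B(c) ∩ c}»), bookkeeping] -/
theorem inΛY_pivIY (c : CBondY x) : inΛY x (pivIY x c) :=
  inΛY_idxOfU x (goodY_of_mem_ublockY x (isCoarseY_of x c).2.1 (upivU_src_mem_ublockY x (isCoarseY_of x c).1)) _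

variable (𝔳 : AvY 𝔸 x)

/-- **SUPPORT OF `C`**: `(C B)(q) = 0` at a bond that is neither a variable (`Λ̃`) nor a pivot. [cite: Balaban1985BackgroundPropagators, (3.157) p.428, bookkeeping] -/
theorem elimCY_apply_eq_zero (U : CfgY 𝔸 x.toKIdx) (B : IBondY x.toKIdx → 𝔸) {q : IBondY x.toKIdx} (h1 : ¬ lamTY x q) (h2 : ¬ IsPivY x q) :
    elimCY x 𝔳 U B q = 0 := by
  classical
  rw [elimCY_apply, secY_apply_of_not h1, Finset.sum_eq_zero, sub_zero]
  intro c _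
  rw [if_neg]
  rintro rfl
  exact h2 ⟨c, rfl⟩

/-- ★ **THE AXIAL GAUGE ON THE RANGE**: `C B = 0` on the tree bonds `⋃_{y ∈ Λ′} Δ_k(y)`. [cite: Balaban1985BackgroundPropagators, (3.157) p.428 («B = 0 on ⋃_{y∈Λ′} Δ_k(y)»)] -/
theorem elimCY_apply_of_isAxialY (U : CfgY 𝔸 x.toKIdx) (B : IBondY x.toKIdx → 𝔸) {q : IBondY x.toKIdx} (hq : IsAxialY x q) :
    elimCY x 𝔳 U B q = 0 :=
  elimCY_apply_eq_zero x 𝔳 U B (fun h => h.2.1 hq) (by rintro ⟨c, rfl⟩; exact not_isAxialY_pivIY x c hq)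

/-- ★ **DIRICHLET CONDITIONS ON THE RANGE**: `C B = 0` off the bonds of `Λ`. [cite: Balaban1985BackgroundPropagators, (3.157) p.428 («B = 0 on Λᶜ»)] -/
theorem elimCY_apply_of_not_inΛY (U : CfgY 𝔸 x.toKIdx) (B : IBondY x.toKIdx → 𝔸) {q : IBondY x.toKIdx} (hq : ¬ inΛY x q) :
    elimCY x 𝔳 U B q = 0 :=
  elimCY_apply_eq_zero x 𝔳 U B (fun h => hq h.1) (by rintro ⟨c, rfl⟩; exact hq (inΛY_pivIY x c))

/-- ★ **`C` IS THE IDENTITY ON `Λ̃`**: `(C B)(q) = B(q)` for `q ∈ Λ̃` (print: *"an identity operator on almost all bonds, except the bonds b₀"*).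
[cite: Balaban1985BackgroundPropagators, (3.157) p.428] -/
theorem elimCY_apply_of_lamTY (U : CfgY 𝔸 x.toKIdx) (B : IBondY x.toKIdx → 𝔸) {q : IBondY x.toKIdx} (hq : lamTY x q) :
    elimCY x 𝔳 U B q = B q := by
  classical
  rw [elimCY_apply, secY_apply_of hq, Finset.sum_eq_zero, sub_zero]
  intro c _
  rw [if_neg]
  rintro rfl
  exact hq.2.2 ⟨c, rfl⟩

/-- **`C` READS ITS ARGUMENT ON `Λ̃` ONLY**: `C P_{Λ̃} = C`. [cite: Balaban1985BackgroundPropagators, (3.157) p.428 («B = CB̃», B̃ a function on Λ̃), bookkeeping] -/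
theorem elimCY_mul_secY (U : CfgY 𝔸 x.toKIdx) : elimCY x 𝔳 U * secY 𝔸 (lamTY x) = elimCY x 𝔳 U := by
  apply LinearMap.ext
  intro B
  have hP : secY 𝔸 (lamTY x) (secY 𝔸 (lamTY x) B) = secY 𝔸 (lamTY x) B := by rw [← Module.End.mul_apply, secY_idem]
  rw [Module.End.mul_apply]
  funext q
  rw [elimCY_apply, elimCY_apply, hP]

/-- **THE RANGE OF `C` CONSISTS OF FUNCTIONS ON THE BONDS OF `Λ`**: `P_Λ C = C`. [cite: Balaban1985BackgroundPropagators, (3.157) p.428 («B = 0 on Λᶜ»), bookkeeping] -/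
theorem secΛY_mul_elimCY (U : CfgY 𝔸 x.toKIdx) : secΛY 𝔸 x * elimCY x 𝔳 U = elimCY x 𝔳 U := by
  apply LinearMap.ext
  intro B
  rw [Module.End.mul_apply]
  funext q
  show secY 𝔸 (inΛY x) (elimCY x 𝔳 U B) q = _
  by_cases hq : inΛY x q
  · rw [secY_apply_of hq]
  · rw [secY_apply_of_not hq, elimCY_apply_of_not_inΛY x 𝔳 U B hq]

/-- ★ **`Q(V)` AT `c` DOES NOT READ THE PIVOTS OF THE OTHER COARSE BONDS**: `(Q(V)(δ_{b₀(c′)} ⊗ a))(c) = 0` for `c′ ≠ c` — the system (3.157) in the pivot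
unknowns is DIAGONAL over `c ∈ Λ′` (print's "exactly one bond b₀ of B(c) contained in c"). [cite: Balaban1985BackgroundPropagators, p.428; Balaban1984PropagatorsII, (2.154)–(2.155) p.249] -/
theorem Q1Y_single_pivIY_of_ne (U : CfgY 𝔸 x.toKIdx) {c c' : CBondY x} (h : c' ≠ c) (a : 𝔸) :
    Q1Y x 𝔳 U c.1 (Pi.single (pivIY x c') a) = 0 := by
  classical
  rw [Q1Y_apply, Finset.sum_eq_zero, smul_zero]
  intro z hz
  rw [trSum_eq_zero, map_zero]
  intro b hb
  unfold pivIY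
  rw [readUY_single, if_neg]
  rintro rfl
  exact h (Subtype.ext (eq_of_upivU_mem_usegY x (isCoarseY_of x c').1 (isCoarseY_of x c).1 hz hb))

/-- the diagonal entry of the system is `K_c`. [cite: Balaban1985BackgroundPropagators, p.428, bookkeeping] -/
theorem Q1Y_single_pivIY_self (U : CfgY 𝔸 x.toKIdx) (c : CBondY x) (a : 𝔸) : Q1Y x 𝔳 U c.1 (Pi.single (pivIY x c) a) = KY x 𝔳 U c a := rfl

open Classical in
/-- `C` as a difference of functions. [cite: Balaban1985BackgroundPropagators, (3.157) p.428, bookkeeping] -/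
theorem elimCY_eq (U : CfgY 𝔸 x.toKIdx) (B : IBondY x.toKIdx → 𝔸) : elimCY x 𝔳 U B =
    secY 𝔸 (lamTY x) B - ∑ c : CBondY x, Pi.single (pivIY x c) (Ring.inverse (KY x 𝔳 U c) (Q1Y x 𝔳 U c.1 (secY 𝔸 (lamTY x) B))) := by
  simp only [elimCY, LinearMap.sub_apply, LinearMap.coe_sum, Finset.sum_apply, LinearMap.comp_apply, LinearMap.single_apply]

/-- ★★ **THE CONSTRAINTS (3.157) HOLD ON THE RANGE OF `C`**: `(Q(V) C(V)B)(c) = 0` at every `c ∈ Λ′` whose pivot coefficient `K_c(V)` is a unit (print: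
*"(CB)(b₀) is equal to a solution of the equation (QB)(c) = 0"*). [cite: Balaban1985BackgroundPropagators, (3.157) p.428] -/
theorem Q1Y_elimCY (U : CfgY 𝔸 x.toKIdx) {c : CBondY x} (hK : IsUnit (KY x 𝔳 U c)) (B : IBondY x.toKIdx → 𝔸) :
    Q1Y x 𝔳 U c.1 (elimCY x 𝔳 U B) = 0 := by
  classical
  have hw : ∀ c' : CBondY x, Q1Y x 𝔳 U c.1 (Pi.single (pivIY x c') (Ring.inverse (KY x 𝔳 U c') (Q1Y x 𝔳 U c'.1 (secY 𝔸 (lamTY x) B)))) =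
      if c' = c then Q1Y x 𝔳 U c.1 (secY 𝔸 (lamTY x) B) else 0 := by
    intro c'
    by_cases h : c' = c
    · subst h
      rw [if_pos rfl, Q1Y_single_pivIY_self, ← Module.End.mul_apply, Ring.mul_inverse_cancel _ hK, Module.End.one_apply]
    · rw [if_neg h]
      exact Q1Y_single_pivIY_of_ne x 𝔳 U h _
  rw [elimCY_eq, map_sub, map_sum, Finset.sum_congr rfl fun c' _ => hw c', Finset.sum_ite_eq', if_pos (Finset.mem_univ _), sub_self]

open Classical in
omit [CompleteSpace 𝔸] in
/-- the restriction to `Λ̃` of a function supported on `Λ̃ ∪ {pivots}` loses exactly the pivot values. [cite: Balaban1985BackgroundPropagators, p.428, bookkeeping] -/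
theorem secY_lamTY_eq_sub (B : IBondY x.toKIdx → 𝔸) (hsupp : ∀ q, ¬ lamTY x q → ¬ IsPivY x q → B q = 0) :
    secY 𝔸 (lamTY x) B = B - ∑ c : CBondY x, Pi.single (pivIY x c) (B (pivIY x c)) := by
  funext q
  simp only [Pi.sub_apply, Finset.sum_apply, Pi.single_apply]
  by_cases h1 : lamTY x q
  · rw [secY_apply_of h1, Finset.sum_eq_zero, sub_zero]
    intro c _
    rw [if_neg]
    rintro rfl
    exact h1.2.2 ⟨c, rfl⟩
  · rw [secY_apply_of_not h1]
    by_cases h2 : IsPivY x q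
    · obtain ⟨c₀, rfl⟩ := h2
      rw [Finset.sum_eq_single c₀, if_pos rfl, sub_self]
      · intro c _ hc
        rw [if_neg]
        exact fun e => hc (pivIY_injective x e.symm)
      · intro h
        exact absurd (Finset.mem_univ _) h
    · rw [Finset.sum_eq_zero, sub_zero, hsupp q h1 h2]
      intro c _
      rw [if_neg]
      rintro rfl
      exact h2 ⟨c, rfl⟩

open Classical in
/-- ★★★ **`C` INVERTS THE RESTRICTION TO `Λ̃` ON THE CONSTRAINED SUBSPACE** («B = CB̃» IS A PARAMETRISATION): a bond function supported on `Λ̃ ∪ {b₀(c)}`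
(i.e. Dirichlet outside `Λ` and in the axial gauge) and satisfying the constraints `(Q(V)B)(c) = 0`, `c ∈ Λ′`, is reproduced from its restriction:
`C(V)(P_{Λ̃}B) = C(V)B = B` (all `K_c(V)` units). [cite: Balaban1985BackgroundPropagators, (3.157) p.428 («an arbitrary function B on this subspace can be represented»)] -/
theorem elimCY_eq_self_of_constraints (U : CfgY 𝔸 x.toKIdx) (B : IBondY x.toKIdx → 𝔸) (hK : ∀ c : CBondY x, IsUnit (KY x 𝔳 U c))
    (hsupp : ∀ q, ¬ lamTY x q → ¬ IsPivY x q → B q = 0) (hQ : ∀ c : CBondY x, Q1Y x 𝔳 U c.1 B = 0) : elimCY x 𝔳 U B = B := by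
  have hdec := secY_lamTY_eq_sub x B hsupp
  have hpiv : ∀ c : CBondY x, Ring.inverse (KY x 𝔳 U c) (Q1Y x 𝔳 U c.1 (secY 𝔸 (lamTY x) B)) = - B (pivIY x c) := by
    intro c
    have hq : Q1Y x 𝔳 U c.1 (secY 𝔸 (lamTY x) B) = - KY x 𝔳 U c (B (pivIY x c)) := by
      rw [hdec, map_sub, hQ c, map_sum, zero_sub, Finset.sum_eq_single c]
      · rfl
      · intro c' _ hc'
        exact Q1Y_single_pivIY_of_ne x 𝔳 U hc' _
      · intro h
        exact absurd (Finset.mem_univ _) h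
    rw [hq, map_neg, ← Module.End.mul_apply, Ring.inverse_mul_cancel _ (hK c), Module.End.one_apply]
  rw [elimCY_eq]
  simp only [hpiv, Pi.single_neg, Finset.sum_neg_distrib, sub_neg_eq_add]
  rw [hdec, sub_add_cancel]

/-! ### the pivot coefficient at `U = 1`: `K_c(1) = L^{−(d+1)}·id` (so the faces above are not vacuous at the record's `U = 1`) -/

omit [NormedAlgebra ℂ 𝔸] [CompleteSpace 𝔸] in
/-- identity transports transport identically along every contour. [cite: Balaban1985BackgroundPropagators, (3.18)–(3.19) p.393 (U = 1), bookkeeping] -/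
theorem hol_apply_of_id [NormedSpace ℝ 𝔸] {Bond : Type} (T : Bond → 𝔸 ≃ₗ[ℝ] 𝔸) (hT : ∀ b v, T b v = v) : ∀ (Γ : List Bond) (v : 𝔸), hol T Γ v = v
  | [], _ => rfl
  | b :: Γ, v => by rw [hol_cons_apply, hol_apply_of_id T hT Γ v, hT]

omit [NormedAlgebra ℂ 𝔸] [CompleteSpace 𝔸] in
/-- with identity transports the transported sum is the plain sum along the contour. [cite: Balaban1985BackgroundPropagators, (3.169) p.430 (U = 1), bookkeeping] -/
theorem trSum_of_id [NormedSpace ℝ 𝔸] {Bond : Type} (T : Bond → 𝔸 ≃ₗ[ℝ] 𝔸) (hT : ∀ b v, T b v = v) (B : Bond → 𝔸) :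
    ∀ Γ : List Bond, trSum T B Γ = (Γ.map B).sum
  | [] => by simp
  | b :: Γ => by rw [trSum_cons, hT, trSum_of_id T hT B Γ, List.map_cons, List.sum_cons]

omit [NormedAlgebra ℂ 𝔸] [CompleteSpace 𝔸] in
/-- a list sum over `range n` is the `Finset.range` sum. [cite: Balaban1985Averaging, (125) p.36, bookkeeping] -/
theorem list_sum_range_map (f : ℕ → 𝔸) : ∀ n : ℕ, ((List.range n).map f).sum = ∑ s ∈ Finset.range n, f s
  | 0 => by simp
  | n + 1 => by
      rw [List.range_succ, List.map_append, List.sum_append, list_sum_range_map f n, Finset.sum_range_succ]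
      simp

omit [NormedAlgebra ℂ 𝔸] [CompleteSpace 𝔸] in
/-- with identity transports the transported sum along `[z, z + L e_μ]` is the plain sum over the `L` segment bonds. [cite: Balaban1985Averaging, (125) p.36 (V = 1), bookkeeping] -/
theorem trSum_usegY_of_id [NormedSpace ℝ 𝔸] (T : UBondY x → 𝔸 ≃ₗ[ℝ] 𝔸) (hT : ∀ b v, T b v = v) (B : UBondY x → 𝔸) (z : USiteY x) (μ : Fin (d + 1)) :
    trSum T B (usegY x z μ) = ∑ s ∈ Finset.range (ℓ + 1), B ⟨ofZ x (labK x z + (s : ℤ) • unitVec μ), μ⟩ := by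
  rw [trSum_of_id T hT, usegY, List.map_map]
  exact list_sum_range_map (fun s : ℕ => B ⟨ofZ x (labK x z + (s : ℤ) • unitVec μ), μ⟩) (ℓ + 1)

/-- **WHICH SEGMENT BOND IS THE PIVOT**: for a corner `y`, `ofZ(labK z + s·e_μ) = b₀((y, μ))₋` iff `z = ofZ(labK y + (L − 1 − s)·e_μ)` (`s < L`).
[cite: Balaban1985BackgroundPropagators, p.428 («exactly one bond b₀»), bookkeeping] -/
theorem ofZ_add_eq_upivU_src_iff {y : USiteY x} (hy : IsCornerY x y) (z : USiteY x) (μ : Fin (d + 1)) {s : ℕ} (hs : s < ℓ + 1) :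
    ofZ x (labK x z + (s : ℤ) • unitVec μ) = (upivU x (y, μ)).src ↔ z = ofZ x (labK x y + ((ℓ : ℤ) - s) • unitVec μ) := by
  have hmem : labK x y + ((ℓ : ℤ) - s) • unitVec μ ∈ B6Elimination.block (ℓ + 1) (corner (ℓ + 1) (labK x y)) :=
    add_smul_unitVec_mem_block x hy μ (by omega) (by omega)
  constructor
  · intro e
    have e2 : ofZ x (labK x z) = ofZ x (labK x y + ((ℓ : ℤ) - s) • unitVec μ) := by
      funext i
      have ei := congrFun e i
      simp only [upivU, ofZ_apply, Pi.add_apply, Pi.smul_apply, unitVec_apply, smul_eq_mul, Int.cast_add, Int.cast_mul, Int.cast_sub,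
        Int.cast_natCast] at ei ⊢
      linear_combination ei
    rwa [ofZ_labK] at e2
  · intro e
    rw [e, labK_ofZ x (inBox_of_mem_block x hmem)]
    show ofZ x _ = ofZ x (labK x y + (ℓ : ℤ) • unitVec μ)
    congr 1
    funext i
    simp only [Pi.add_apply, Pi.smul_apply, smul_eq_mul]
    ring

/-- the `L` unit sites `y + t·e_μ`, `0 ≤ t ≤ L − 1`, of the axis of `c` inside `B(c₋)`. [cite: Balaban1985BackgroundPropagators, p.428 («B(c) ∩ c»), bookkeeping] -/
theorem ofZ_add_mem_ublockY {y : USiteY x} (hy : IsCornerY x y) (μ : Fin (d + 1)) {t : ℤ} (h0 : 0 ≤ t) (ht : t ≤ ℓ) :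
    ofZ x (labK x y + t • unitVec μ) ∈ ublockY x y := by
  have hmem := add_smul_unitVec_mem_block x hy μ h0 ht
  rw [mem_ublockY, labK_ofZ x (inBox_of_mem_block x hmem), corner_eq_of_mem_block ell_succ_pos hmem]

/-- ★★ **THE PIVOT COEFFICIENT AT `U = 1` IS THE SCALAR `L^{−(d+1)}`**: at the record's averaged field (`V(1) = 1`, identity transports) exactly `L` of the `L·L^{d+1}`
(segment, bond) pairs of `(Q(1)·)(c)` read the pivot `b₀(c)` — one per segment of the axis of `c`. In particular `K_c(1)` is a unit and the faces
`Q1Y_elimCY`, `elimCY_eq_self_of_constraints`, `sum_tr_elimCY_mul` are not vacuous at `U = 1`. [cite: Balaban1985Averaging, (125) p.36; Balaban1985BackgroundPropagators, p.428; Balaban1984PropagatorsII, (2.154) p.249] -/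
theorem KY_one (c : CBondY x) (a : 𝔸) :
    KY x (avYOfRecord x) (fun _ _ => 1 : CfgY 𝔸 x.toKIdx) c a = ((((ℓ + 1 : ℕ) : ℂ)) ^ (d + 1))⁻¹ • a := by
  classical
  obtain ⟨⟨y, μ⟩, hc⟩ := c
  have hy : IsCornerY x y := ((mem_coarseY x).1 hc).1
  have hT : ∀ (b : UBondY x) (v : 𝔸), RUY x (avYOfRecord x) (fun _ _ => 1 : CfgY 𝔸 x.toKIdx) b v = v := fun b v => by
    rw [RUY_apply, avYOfRecord_one, R_one]
  rw [KY_apply, Q1Y_apply]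
  unfold pivIY
  simp only [hol_apply_of_id _ (RVY_avYOfRecord_one x), trSum_usegY_of_id x _ hT, readUY_single]
  rw [Finset.sum_comm]
  have hs : ∀ s ∈ Finset.range (ℓ + 1),
      (∑ z ∈ ublockY x y, if (⟨ofZ x (labK x z + (s : ℤ) • unitVec μ), μ⟩ : UBondY x) = upivU x (y, μ) then a else 0) = a := by
    intro s hs
    rw [Finset.mem_range] at hs
    have hiff : ∀ z : USiteY x, (⟨ofZ x (labK x z + (s : ℤ) • unitVec μ), μ⟩ : UBondY x) = upivU x (y, μ) ↔
        z = ofZ x (labK x y + ((ℓ : ℤ) - s) • unitVec μ) := by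
      intro z
      rw [← ofZ_add_eq_upivU_src_iff x hy z μ hs]
      constructor
      · intro e; exact congrArg PBond.src e
      · intro e; exact congrArg (fun w => (⟨w, μ⟩ : UBondY x)) e
    simp_rw [hiff]
    rw [Finset.sum_ite_eq', if_pos (ofZ_add_mem_ublockY x hy μ (by omega) (by omega))]
  rw [Finset.sum_congr rfl hs, Finset.sum_const, Finset.card_range, ← Nat.cast_smul_eq_nsmul ℂ, smul_smul, qNormY, pow_succ, mul_inv,
    inv_mul_cancel_right₀ (Nat.cast_ne_zero.2 (Nat.succ_ne_zero ℓ))]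

/-- ★ at `U = 1` every pivot coefficient is a unit. [cite: Balaban1985BackgroundPropagators, p.428, bookkeeping] -/
theorem isUnit_KY_one (c : CBondY x) : IsUnit (KY x (avYOfRecord x) (fun _ _ => 1 : CfgY 𝔸 x.toKIdx) c) := by
  have hL : ((((ℓ + 1 : ℕ) : ℂ)) ^ (d + 1))⁻¹ ≠ 0 := inv_ne_zero (pow_ne_zero _ (Nat.cast_ne_zero.2 (Nat.succ_ne_zero ℓ)))
  have e : KY x (avYOfRecord x) (fun _ _ => 1 : CfgY 𝔸 x.toKIdx) c = ((((ℓ + 1 : ℕ) : ℂ)) ^ (d + 1))⁻¹ • (1 : Module.End ℂ 𝔸) := by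
    apply LinearMap.ext
    intro a
    rw [KY_one, LinearMap.smul_apply, Module.End.one_apply]
  rw [e, ← Algebra.algebraMap_eq_smul_one]
  exact (isUnit_iff_ne_zero.2 hL).map (algebraMap ℂ (Module.End ℂ 𝔸))

/-- ★ **AT `U = 1` THE CONSTRAINTS HOLD ON THE RANGE OF `C(1)` UNCONDITIONALLY**. [cite: Balaban1985BackgroundPropagators, (3.157) p.428; Balaban1984PropagatorsII, (2.154)–(2.156) pp.249–250] -/
theorem Q1Y_elimCY_one (c : CBondY x) (B : IBondY x.toKIdx → 𝔸) :
    Q1Y x (avYOfRecord x) (fun _ _ => 1 : CfgY 𝔸 x.toKIdx) c.1 (elimCY x (avYOfRecord x) (fun _ _ => 1) B) = 0 :=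
  Q1Y_elimCY x (avYOfRecord x) _ (isUnit_KY_one x c) B

/-- ★ **AT `U = 1`, `C(1)` REPRODUCES EVERY CONSTRAINED AXIAL FUNCTION** ([4]'s flat parametrisation (2.154)–(2.156) on NODE 00's carrier).
[cite: Balaban1984PropagatorsII, (2.154)–(2.156) pp.249–250; Balaban1985BackgroundPropagators, (3.157) p.428] -/
theorem elimCY_one_eq_self_of_constraints (B : IBondY x.toKIdx → 𝔸) (hsupp : ∀ q, ¬ lamTY x q → ¬ IsPivY x q → B q = 0)
    (hQ : ∀ c : CBondY x, Q1Y x (avYOfRecord x) (fun _ _ => 1 : CfgY 𝔸 x.toKIdx) c.1 B = 0) :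
    elimCY x (avYOfRecord x) (fun _ _ => 1) B = B :=
  elimCY_eq_self_of_constraints x (avYOfRecord x) _ B (isUnit_KY_one x) hsupp hQ

end Faces

/-! ## §4 The transpose `C*` for the trace pairing `Σ_q τ(B(q)A(q))` and the adjointness `Σ τ((CB̃)·A) = Σ τ(B̃·(C*A))` -/

section Transpose

variable {𝔸 : Type} [NormedRing 𝔸] [NormedAlgebra ℂ 𝔸] [CompleteSpace 𝔸]
variable (x : MemberY d ℓ hd hL b₀ b₁ Mstar)

open Classical in
/-- **PLACING a unit-bond function on NODE 00's bond carrier** (the transpose of `readUY`: the value at the unit bond `b` sourced in `Ω_k^{(k)}` is placed at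
`idxOfU b`; zero at index bonds that are not of this form). [cite: Balaban1984PropagatorsII, (2.3) p.224; Balaban1985BackgroundPropagators, (3.9) p.391, dictionary] -/
def placeUY (W : UBondY x → 𝔸) : IBondY x.toKIdx → 𝔸 := fun q =>
  ∑ b : UBondY x, if h : b.src ∈ (domT x.hN x.D x.hk).Om x.k then (if idxOfU x b h = q then W b else 0) else 0

omit [NormedAlgebra ℂ 𝔸] [CompleteSpace 𝔸] in
/-- the placed function at `idxOfU b` is `W b`. [cite: Balaban1984PropagatorsII, (2.3) p.224, bookkeeping] -/
theorem placeUY_idxOfU (W : UBondY x → 𝔸) (b : UBondY x) (h : b.src ∈ (domT x.hN x.D x.hk).Om x.k) : placeUY x W (idxOfU x b h) = W b := by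
  classical
  unfold placeUY
  rw [Finset.sum_eq_single b]
  · rw [dif_pos h, if_pos rfl]
  · intro b' _ hb'
    by_cases h' : b'.src ∈ (domT x.hN x.D x.hk).Om x.k
    · rw [dif_pos h', if_neg]
      exact fun e => hb' (idxOfU_inj x e)
    · rw [dif_neg h']
  · intro hb
    exact absurd (Finset.mem_univ _) hb

omit [NormedAlgebra ℂ 𝔸] [CompleteSpace 𝔸] in
/-- placing is additive. [cite: Balaban1985BackgroundPropagators, (3.9) p.391, bookkeeping] -/
theorem placeUY_add (W W' : UBondY x → 𝔸) : placeUY x (W + W') = placeUY x W + placeUY x W' := by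
  classical
  funext q
  simp only [placeUY, Pi.add_apply, ← Finset.sum_add_distrib]
  refine Finset.sum_congr rfl fun b _ => ?_
  split_ifs <;> simp

omit [CompleteSpace 𝔸] in
/-- placing is homogeneous. [cite: Balaban1985BackgroundPropagators, (3.9) p.391, bookkeeping] -/
theorem placeUY_smul (a : ℂ) (W : UBondY x → 𝔸) : placeUY x (a • W) = a • placeUY x W := by
  classical
  funext q
  simp only [placeUY, Pi.smul_apply, Finset.smul_sum]
  refine Finset.sum_congr rfl fun b _ => ?_
  split_ifs <;> simp

omit [CompleteSpace 𝔸] in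
/-- ★ **`placeUY` IS THE TRANSPOSE OF `readUY`**: `Σ_b τ((readUY B)(b)·W(b)) = Σ_q τ(B(q)·(placeUY W)(q))` for any additive `τ`. [cite: Balaban1985BackgroundPropagators, (3.9) p.391, bookkeeping] -/
theorem sum_tr_readUY_mul (τ : 𝔸 →ₗ[ℂ] ℂ) (B : IBondY x.toKIdx → 𝔸) (W : UBondY x → 𝔸) :
    ∑ b, τ (readUY x B b * W b) = ∑ q, τ (B q * placeUY x W q) := by
  classical
  have hb : ∀ b : UBondY x, τ (readUY x B b * W b) = ∑ q : IBondY x.toKIdx,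
      τ (B q * (if h : b.src ∈ (domT x.hN x.D x.hk).Om x.k then (if idxOfU x b h = q then W b else 0) else 0)) := by
    intro b
    by_cases h : b.src ∈ (domT x.hN x.D x.hk).Om x.k
    · rw [readUY_apply_of_mem x B h]
      simp only [dif_pos h]
      rw [Finset.sum_eq_single (idxOfU x b h)]
      · rw [if_pos rfl]
      · intro q _ hq
        rw [if_neg (Ne.symm hq), mul_zero, map_zero]
      · intro hq
        exact absurd (Finset.mem_univ _) hq
    · rw [readUY_apply_of_not_mem x B h, zero_mul, map_zero]
      simp only [dif_neg h, mul_zero, map_zero, Finset.sum_const_zero]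
  simp only [hb]
  rw [Finset.sum_comm]
  refine Finset.sum_congr rfl fun q _ => ?_
  simp only [placeUY, Finset.mul_sum, map_sum]

variable (𝔳 : AvY 𝔸 x)

/-- **THE ADJOINT UNIT-BOND TRANSPORTS `R(V(b))* = R(V(b)⁻¹)`**. [cite: Balaban1985BackgroundPropagators, p.390 + (3.9) p.391; Balaban1985Averaging, (57) p.27] -/
def RUTY (U : CfgY 𝔸 x.toKIdx) (b : UBondY x) : 𝔸 ≃ₗ[ℝ] 𝔸 := (RUY x 𝔳 U b).symm

/-- `RUTY` evaluated. [cite: Balaban1985Averaging, (57) p.27, bookkeeping] -/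
@[simp] theorem RUTY_apply (U : CfgY 𝔸 x.toKIdx) (b : UBondY x) (v : 𝔸) : RUTY x 𝔳 U b v = R (𝔳 U b)⁻¹ v := rfl

/-- `symmFam RUTY = RUY`. [cite: Balaban1985Averaging, (57) p.27, bookkeeping] -/
theorem symmFam_RUTY (U : CfgY 𝔸 x.toKIdx) : symmFam (RUTY x 𝔳 U) = RUY x 𝔳 U := rfl

/-- the adjoint unit-bond transports commute with complex scalars. [cite: Balaban1985Averaging, (57) p.27, bookkeeping] -/
theorem RUTY_smulC (U : CfgY 𝔸 x.toKIdx) : ∀ (b : UBondY x) (c : ℂ) (v : 𝔸), RUTY x 𝔳 U b (c • v) = c • RUTY x 𝔳 U b v :=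
  fun _ c v => R_smul _ c v

/-- the inverse of the transport along a contour is `ℂ`-homogeneous. [cite: Balaban1985BackgroundPropagators, (3.169) p.430, bookkeeping] -/
theorem hol_RVY_symm_smulC (U : CfgY 𝔸 x.toKIdx) (a : ℂ) (Γ : List (IBondY x.toKIdx)) (v : 𝔸) :
    (hol (RVY x 𝔳 U) Γ).symm (a • v) = a • (hol (RVY x 𝔳 U) Γ).symm v := by
  rw [LinearEquiv.symm_apply_eq, hol_smulC (RVY x 𝔳 U) (RVY_smulC x 𝔳 U), LinearEquiv.apply_symm_apply]

/-- `R(V)* = R(V⁻¹)` for the trace form, unit bonds. [cite: Balaban1985BackgroundPropagators, (3.9) p.391 + p.390] -/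
theorem trFormY_RUY (τ : 𝔸 →ₗ[ℂ] ℂ) (hτ : ∀ a b : 𝔸, τ (a * b) = τ (b * a)) (U : CfgY 𝔸 x.toKIdx) :
    ∀ (b : UBondY x) (u v : 𝔸), trFormY τ (RUY x 𝔳 U b u) v = trFormY τ u (RUTY x 𝔳 U b v) :=
  fun b u v => by rw [trFormY_apply, trFormY_apply, RUY_apply, RUTY_apply]; exact trace_R_mul τ hτ _ u v

/-- **THE TRANSPOSE OF THE TRANSPORT ALONG A CONTOUR IS ITS INVERSE**: `τ(R(V(Γ))u · v) = τ(u · R(V(Γ))⁻¹v)`. [cite: Balaban1985BackgroundPropagators, (3.9) p.391 + p.390] -/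
theorem tr_hol_mul (τ : 𝔸 →ₗ[ℂ] ℂ) (hτ : ∀ a b : 𝔸, τ (a * b) = τ (b * a)) (U : CfgY 𝔸 x.toKIdx) (Γ : List (IBondY x.toKIdx)) (u v : 𝔸) :
    τ (hol (RVY x 𝔳 U) Γ u * v) = τ (u * (hol (RVY x 𝔳 U) Γ).symm v) := by
  have h := pair_hol_symm_apply (RVTY x 𝔳 U) (trFormY τ) (RVY x 𝔳 U) (trFormY_RVY τ hτ U) Γ (hol (RVY x 𝔳 U) Γ u)
    ((hol (RVY x 𝔳 U) Γ).symm v)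
  rw [LinearEquiv.symm_apply_apply, symmFam_RVTY, LinearEquiv.apply_symm_apply, trFormY_apply, trFormY_apply] at h
  exact h.symm

open Classical in
/-- **THE TRANSPOSE OF (125) before normalisation**: `v ↦ Σ_{z ∈ B(c₋)} place(trSumT(R(V)*)([z, z(c)]) (R(V(Γ_{c₋,z}))⁻¹ v))`. [cite: Balaban1985Averaging, (125) p.36; Balaban1985BackgroundPropagators, (3.9) p.391] -/
def q1TFunY (U : CfgY 𝔸 x.toKIdx) (c : USiteY x × Fin (d + 1)) (v : 𝔸) : IBondY x.toKIdx → 𝔸 :=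
  ∑ z ∈ ublockY x c.1, placeUY x (trSumT (RUTY x 𝔳 U) (usegY x z c.2) ((hol (RVY x 𝔳 U) (uΓ x z)).symm v))

/-- the transpose of (125) is additive. [cite: Balaban1985Averaging, (125) p.36, bookkeeping] -/
theorem q1TFunY_add (U : CfgY 𝔸 x.toKIdx) (c : USiteY x × Fin (d + 1)) (v v' : 𝔸) :
    q1TFunY x 𝔳 U c (v + v') = q1TFunY x 𝔳 U c v + q1TFunY x 𝔳 U c v' := by
  classical
  simp only [q1TFunY, map_add, trSumT_add, placeUY_add, Finset.sum_add_distrib]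

/-- the transpose of (125) is `ℂ`-homogeneous. [cite: Balaban1985Averaging, (125) p.36, bookkeeping] -/
theorem q1TFunY_smul (U : CfgY 𝔸 x.toKIdx) (c : USiteY x × Fin (d + 1)) (a : ℂ) (v : 𝔸) :
    q1TFunY x 𝔳 U c (a • v) = a • q1TFunY x 𝔳 U c v := by
  classical
  simp only [q1TFunY, hol_RVY_symm_smulC, trSumT_smulC (RUTY x 𝔳 U) (RUTY_smulC x 𝔳 U), placeUY_smul, Finset.smul_sum]

/-- ★ **`Q(V)*` AT A COARSE BOND**: the transpose `v ↦ (Q(V)(·)(c))*v` of the linear form `Q1Y c` for the pairing `Σ_q τ(B(q)A(q))`, as a `ℂ`-linear map into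
the bond functions (the letter through which `C*` of (3.157) acts). [cite: Balaban1985BackgroundPropagators, (3.157) p.428 («C*»), (3.9) p.391; Balaban1985Averaging, (125) p.36] -/
def Q1TY (U : CfgY 𝔸 x.toKIdx) (c : USiteY x × Fin (d + 1)) : 𝔸 →ₗ[ℂ] (IBondY x.toKIdx → 𝔸) where
  toFun v := qNormY d ℓ • q1TFunY x 𝔳 U c v
  map_add' v v' := by rw [q1TFunY_add, smul_add]
  map_smul' a v := by rw [q1TFunY_smul, smul_comm, RingHom.id_apply]

/-- `Q(V)*` evaluated. [cite: Balaban1985BackgroundPropagators, (3.157) p.428, bookkeeping] -/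
theorem Q1TY_apply (U : CfgY 𝔸 x.toKIdx) (c : USiteY x × Fin (d + 1)) (v : 𝔸) : Q1TY x 𝔳 U c v = qNormY d ℓ • q1TFunY x 𝔳 U c v := rfl

/-- ★★ **`Q(V)*` IS THE TRANSPOSE OF `Q(V)`**: `τ((Q(V)B)(c) · v) = Σ_q τ(B(q) · (Q(V)* v)(q))` for every tracial `τ`. [cite: Balaban1985BackgroundPropagators, (3.9) p.391 + p.390, (3.157) p.428] -/
theorem tr_Q1Y_mul (τ : 𝔸 →ₗ[ℂ] ℂ) (hτ : ∀ a b : 𝔸, τ (a * b) = τ (b * a)) (U : CfgY 𝔸 x.toKIdx) (c : USiteY x × Fin (d + 1))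
    (B : IBondY x.toKIdx → 𝔸) (v : 𝔸) : τ (Q1Y x 𝔳 U c B * v) = ∑ q, τ (B q * Q1TY x 𝔳 U c v q) := by
  classical
  rw [Q1Y_apply, smul_mul_assoc, map_smul, Finset.sum_mul, map_sum]
  have hz : ∀ z ∈ ublockY x c.1, τ (hol (RVY x 𝔳 U) (uΓ x z) (trSum (RUY x 𝔳 U) (readUY x B) (usegY x z c.2)) * v) =
      ∑ q, τ (B q * placeUY x (trSumT (RUTY x 𝔳 U) (usegY x z c.2) ((hol (RVY x 𝔳 U) (uΓ x z)).symm v)) q) := by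
    intro z _
    rw [tr_hol_mul x 𝔳 τ hτ]
    have h := pair_trSum (RUTY x 𝔳 U) (trFormY τ) (RUY x 𝔳 U) (trFormY_RUY x 𝔳 τ hτ U) (readUY x B) (usegY x z c.2)
      ((hol (RVY x 𝔳 U) (uΓ x z)).symm v)
    simp only [trFormY_apply] at h
    rw [h, sum_tr_readUY_mul]
  rw [Finset.sum_congr rfl hz, Finset.sum_comm]
  simp only [Q1TY_apply, q1TFunY, Pi.smul_apply, Finset.sum_apply, mul_smul_comm, map_smul, Finset.mul_sum, map_sum, Finset.smul_sum]

open Classical in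
/-- **THE TRANSPOSE `K_c(V)*` OF THE PIVOT COEFFICIENT**: `v ↦ (Q(V)* v)(b₀(c))`. [cite: Balaban1985BackgroundPropagators, p.428, (3.9) p.391, bookkeeping] -/
def KTY (U : CfgY 𝔸 x.toKIdx) (c : CBondY x) : Module.End ℂ 𝔸 := LinearMap.proj (pivIY x c) ∘ₗ Q1TY x 𝔳 U c.1

/-- `K_c*` evaluated. [cite: Balaban1985BackgroundPropagators, p.428, bookkeeping] -/
theorem KTY_apply (U : CfgY 𝔸 x.toKIdx) (c : CBondY x) (v : 𝔸) : KTY x 𝔳 U c v = Q1TY x 𝔳 U c.1 v (pivIY x c) := rfl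

/-- ★ **`K_c*` IS THE TRANSPOSE OF `K_c`**: `τ(K_c a · v) = τ(a · K_c* v)`. [cite: Balaban1985BackgroundPropagators, (3.9) p.391, p.428] -/
theorem tr_KY_mul (τ : 𝔸 →ₗ[ℂ] ℂ) (hτ : ∀ a b : 𝔸, τ (a * b) = τ (b * a)) (U : CfgY 𝔸 x.toKIdx) (c : CBondY x) (a v : 𝔸) :
    τ (KY x 𝔳 U c a * v) = τ (a * KTY x 𝔳 U c v) := by
  classical
  rw [KY_apply, tr_Q1Y_mul x 𝔳 τ hτ, Finset.sum_eq_single (pivIY x c)]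
  · rw [Pi.single_eq_same, KTY_apply]
  · intro q _ hq
    rw [Pi.single_eq_of_ne hq, zero_mul, map_zero]
  · intro h
    exact absurd (Finset.mem_univ _) h

/-- ★ **THE TRANSPOSE OF `K_c⁻¹` IS `(K_c*)⁻¹`** (both units). [cite: Balaban1985BackgroundPropagators, (3.9) p.391, p.428, bookkeeping] -/
theorem tr_inverse_KY_mul (τ : 𝔸 →ₗ[ℂ] ℂ) (hτ : ∀ a b : 𝔸, τ (a * b) = τ (b * a)) (U : CfgY 𝔸 x.toKIdx) (c : CBondY x)
    (hK : IsUnit (KY x 𝔳 U c)) (hKT : IsUnit (KTY x 𝔳 U c)) (a v : 𝔸) :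
    τ (Ring.inverse (KY x 𝔳 U c) a * v) = τ (a * Ring.inverse (KTY x 𝔳 U c) v) := by
  have ha : KY x 𝔳 U c (Ring.inverse (KY x 𝔳 U c) a) = a := by
    rw [← Module.End.mul_apply, Ring.mul_inverse_cancel _ hK, Module.End.one_apply]
  have hv : KTY x 𝔳 U c (Ring.inverse (KTY x 𝔳 U c) v) = v := by
    rw [← Module.End.mul_apply, Ring.mul_inverse_cancel _ hKT, Module.End.one_apply]
  calc τ (Ring.inverse (KY x 𝔳 U c) a * v) = τ (Ring.inverse (KY x 𝔳 U c) a * KTY x 𝔳 U c (Ring.inverse (KTY x 𝔳 U c) v)) := by rw [hv]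
    _ = τ (KY x 𝔳 U c (Ring.inverse (KY x 𝔳 U c) a) * Ring.inverse (KTY x 𝔳 U c) v) := (tr_KY_mul x 𝔳 τ hτ U c _ _).symm
    _ = τ (a * Ring.inverse (KTY x 𝔳 U c) v) := by rw [ha]

open Classical in
/-- ★★★ **THE LETTER `C*` OF (3.157)** — the transpose of `C(V)` for the trace pairing: `C(V)* = P_{Λ̃} − Σ_{c ∈ Λ′} P_{Λ̃} Q(V)*_c (K_c(V)*)⁻¹ ev_{b₀(c)}`
(NODE 00 transposes letters FLAT with respect to a tracial `τ`, with `R(V)* = R(V⁻¹)`, cf. `muTY ∕ DbarTY`). [cite: Balaban1985BackgroundPropagators, (3.157) p.428 («C*g»), (3.9) p.391] -/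
def elimCtY : IBondOpY 𝔸 x.toKIdx := fun U =>
  secY 𝔸 (lamTY x) - ∑ c : CBondY x,
    secY 𝔸 (lamTY x) ∘ₗ Q1TY x 𝔳 U c.1 ∘ₗ Ring.inverse (KTY x 𝔳 U c) ∘ₗ LinearMap.proj (pivIY x c)

open Classical in
/-- `C*` as a difference of functions. [cite: Balaban1985BackgroundPropagators, (3.157) p.428, bookkeeping] -/
theorem elimCtY_eq (U : CfgY 𝔸 x.toKIdx) (A : IBondY x.toKIdx → 𝔸) : elimCtY x 𝔳 U A =
    secY 𝔸 (lamTY x) A - ∑ c : CBondY x, secY 𝔸 (lamTY x) (Q1TY x 𝔳 U c.1 (Ring.inverse (KTY x 𝔳 U c) (A (pivIY x c)))) := by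
  simp only [elimCtY, LinearMap.sub_apply, LinearMap.coe_sum, Finset.sum_apply, LinearMap.comp_apply, LinearMap.proj_apply]

omit [CompleteSpace 𝔸] in
/-- `P_S` is self-transposed for the pairing `Σ_q τ(B(q)A(q))`. [cite: Balaban1985BackgroundPropagators, (3.9) p.391, bookkeeping] -/
theorem sum_tr_secY_mul (τ : 𝔸 →ₗ[ℂ] ℂ) (S : IBondY x.toKIdx → Prop) (B A : IBondY x.toKIdx → 𝔸) :
    ∑ q, τ (secY 𝔸 S B q * A q) = ∑ q, τ (B q * secY 𝔸 S A q) := by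
  refine Finset.sum_congr rfl fun q _ => ?_
  by_cases h : S q
  · rw [secY_apply_of h, secY_apply_of h]
  · rw [secY_apply_of_not h, secY_apply_of_not h, zero_mul, mul_zero]

/-- ★★★ **`C*` IS THE TRANSPOSE OF `C`**: `Σ_q τ((C(V)B)(q)·A(q)) = Σ_q τ(B(q)·(C(V)*A)(q))` for every tracial `τ`, whenever the pivot coefficients `K_c(V)`
and their transposes are units. [cite: Balaban1985BackgroundPropagators, (3.157) p.428, (3.9) p.391 + p.390] -/
theorem sum_tr_elimCY_mul (τ : 𝔸 →ₗ[ℂ] ℂ) (hτ : ∀ a b : 𝔸, τ (a * b) = τ (b * a)) (U : CfgY 𝔸 x.toKIdx)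
    (hK : ∀ c : CBondY x, IsUnit (KY x 𝔳 U c)) (hKT : ∀ c : CBondY x, IsUnit (KTY x 𝔳 U c)) (B A : IBondY x.toKIdx → 𝔸) :
    ∑ q, τ (elimCY x 𝔳 U B q * A q) = ∑ q, τ (B q * elimCtY x 𝔳 U A q) := by
  classical
  have hc : ∀ c : CBondY x,
      ∑ q, τ ((Pi.single (pivIY x c) (Ring.inverse (KY x 𝔳 U c) (Q1Y x 𝔳 U c.1 (secY 𝔸 (lamTY x) B))) : IBondY x.toKIdx → 𝔸) q * A q) =
        ∑ q, τ (B q * secY 𝔸 (lamTY x) (Q1TY x 𝔳 U c.1 (Ring.inverse (KTY x 𝔳 U c) (A (pivIY x c)))) q) := by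
    intro c
    rw [Finset.sum_eq_single (pivIY x c) (fun q _ hq => by rw [Pi.single_eq_of_ne hq, zero_mul, map_zero])
      (fun h => absurd (Finset.mem_univ _) h), Pi.single_eq_same, tr_inverse_KY_mul x 𝔳 τ hτ U c (hK c) (hKT c),
      tr_Q1Y_mul x 𝔳 τ hτ, sum_tr_secY_mul]
  simp only [elimCY_eq, elimCtY_eq, Pi.sub_apply, Finset.sum_apply, sub_mul, mul_sub, map_sub, Finset.sum_mul, Finset.mul_sum, map_sum,
    Finset.sum_sub_distrib]
  rw [sum_tr_secY_mul, Finset.sum_comm, Finset.sum_congr rfl fun c _ => hc c, Finset.sum_comm]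

/-- **THE RANGE OF `C*` CONSISTS OF FUNCTIONS ON `Λ̃`**: `P_{Λ̃} C* = C*`. [cite: Balaban1985BackgroundPropagators, (3.157) p.428 («C*g» a function on Λ̃), bookkeeping] -/
theorem secY_mul_elimCtY (U : CfgY 𝔸 x.toKIdx) : secY 𝔸 (lamTY x) * elimCtY x 𝔳 U = elimCtY x 𝔳 U := by
  apply LinearMap.ext
  intro A
  have hP : ∀ f : IBondY x.toKIdx → 𝔸, secY 𝔸 (lamTY x) (secY 𝔸 (lamTY x) f) = secY 𝔸 (lamTY x) f := fun f => by
    rw [← Module.End.mul_apply, secY_idem]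
  rw [Module.End.mul_apply, elimCtY_eq, map_sub, map_sum]
  simp only [hP]

/-- **`C*` READS ITS ARGUMENT ON THE BONDS OF `Λ` ONLY**: `C* P_Λ = C*`. [cite: Balaban1985BackgroundPropagators, (3.157) p.428 («g … defined at bonds of Λ»), bookkeeping] -/
theorem elimCtY_mul_secΛY (U : CfgY 𝔸 x.toKIdx) : elimCtY x 𝔳 U * secΛY 𝔸 x = elimCtY x 𝔳 U := by
  apply LinearMap.ext
  intro A
  have hP : secY 𝔸 (lamTY x) (secΛY 𝔸 x A) = secY 𝔸 (lamTY x) A := by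
    rw [← Module.End.mul_apply]
    exact congrFun (congrArg DFunLike.coe (secY_mul_secY_of_imp' (𝔸 := 𝔸) (lamTY_inΛ x))) A
  have hpiv : ∀ c : CBondY x, secΛY 𝔸 x A (pivIY x c) = A (pivIY x c) := fun c => secY_apply_of (inΛY_pivIY x c) A
  rw [Module.End.mul_apply, elimCtY_eq, elimCtY_eq, hP]
  simp only [hpiv]

end Transpose

/-! ## §5 The Sect. E letter record with `Λ̃ ∕ C ∕ C*` filled, and the v6 instance of record -/

section LettersTC

variable {𝔸 : Type} [NormedRing 𝔸] [NormedAlgebra ℂ 𝔸] [CompleteSpace 𝔸]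
variable (x : MemberY d ℓ hd hL b₀ b₁ Mstar) (𝔳 : AvY 𝔸 x)

/-- ★★ **THE SEVEN-LETTER SECT. E RECORD**: `𝔢₀` with `μ ∕ D̄ ∕ μ* ∕ D̄*` (FILE (14)∕(15)) AND `Λ̃ ∕ C ∕ C*` (this file) genuine over the averaged-field parameter;
`⟨D̃⁽²⁾, J⟩` ((3.156), [5]'s second-order term) and `G̃₂` ((3.184)–(3.186)) stay `𝔢₀`'s parameters. [cite: Balaban1985BackgroundPropagators, (3.157) p.428, (3.168)–(3.169) p.430, (3.185) p.432] -/
def sectELettersYOfRecordTC (𝔢₀ : SectELettersY 𝔸 x) : SectELettersY 𝔸 x :=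
  sectELettersYOfRecordT x 𝔳
    { 𝔢₀ with LamT := lamTY x, LamT_inΛ := lamTY_inΛ x, elimC := elimCY x 𝔳, elimCt := elimCtY x 𝔳 }

/-- the seven-letter record's letters. [cite: Balaban1985BackgroundPropagators, (3.157) p.428, (3.168)–(3.169) p.430, bookkeeping] -/
theorem sectELettersYOfRecordTC_letters (𝔢₀ : SectELettersY 𝔸 x) :
    (sectELettersYOfRecordTC x 𝔳 𝔢₀).LamT = lamTY x ∧ (sectELettersYOfRecordTC x 𝔳 𝔢₀).elimC = elimCY x 𝔳 ∧
      (sectELettersYOfRecordTC x 𝔳 𝔢₀).elimCt = elimCtY x 𝔳 ∧ (sectELettersYOfRecordTC x 𝔳 𝔢₀).mu = muY x 𝔳 ∧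
      (sectELettersYOfRecordTC x 𝔳 𝔢₀).Dbar = DbarY x 𝔳 ∧ (sectELettersYOfRecordTC x 𝔳 𝔢₀).muT = muTY x 𝔳 ∧
      (sectELettersYOfRecordTC x 𝔳 𝔢₀).DbarT = DbarTY x 𝔳 :=
  ⟨rfl, rfl, rfl, rfl, rfl, rfl, rfl⟩

/-- the seven-letter record keeps `𝔢₀`'s `⟨D̃⁽²⁾, J⟩` and `G̃₂`. [cite: Balaban1985BackgroundPropagators, (3.156) p.428, (3.186) p.432, bookkeeping] -/
theorem sectELettersYOfRecordTC_params (𝔢₀ : SectELettersY 𝔸 x) :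
    (sectELettersYOfRecordTC x 𝔳 𝔢₀).D2J = 𝔢₀.D2J ∧ (sectELettersYOfRecordTC x 𝔳 𝔢₀).Gt2 = 𝔢₀.Gt2 := ⟨rfl, rfl⟩

/-- ★ **n06-m's `P_Λ C P_{Λ̃}` AT THE RECORD IS `C(V)` ITSELF** (its range lies in the `Λ`-functions, it reads `Λ̃` only). [cite: Balaban1985BackgroundPropagators, (3.157) p.428, bookkeeping] -/
theorem elimCΛY_sectELettersYOfRecordTC (𝔢₀ : SectELettersY 𝔸 x) (U : CfgY 𝔸 x.toKIdx) :
    elimCΛY x (sectELettersYOfRecordTC x 𝔳 𝔢₀) U = elimCY x 𝔳 U := by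
  show secΛY 𝔸 x * elimCY x 𝔳 U * secY 𝔸 (lamTY x) = _
  rw [secΛY_mul_elimCY, elimCY_mul_secY]

/-- ★ **n06-m's `P_{Λ̃} C* P_Λ` AT THE RECORD IS `C(V)*` ITSELF**. [cite: Balaban1985BackgroundPropagators, (3.157) p.428, bookkeeping] -/
theorem elimCtΛY_sectELettersYOfRecordTC (𝔢₀ : SectELettersY 𝔸 x) (U : CfgY 𝔸 x.toKIdx) :
    elimCtΛY x (sectELettersYOfRecordTC x 𝔳 𝔢₀) U = elimCtY x 𝔳 U := by
  show secY 𝔸 (lamTY x) * elimCtY x 𝔳 U * secΛY 𝔸 x = _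
  rw [secY_mul_elimCtY, elimCtY_mul_secΛY]

/-- **(3.158) AT THE RECORD, UNFOLDED**: `C^{(k)}(Λ; U) = C(V) · C̃^{(k)}(Λ; U) · C(V)*` with this file's `C`, `C*`. [cite: Balaban1985BackgroundPropagators, (3.158) p.428] -/
theorem CkY_sectELettersYOfRecordTC (𝔏 : CovLettersY 𝔸 x) (𝔢₀ : SectELettersY 𝔸 x) (U : CfgY 𝔸 x.toKIdx) :
    CkY x 𝔏 (sectELettersYOfRecordTC x 𝔳 𝔢₀) U =
      elimCY x 𝔳 U * CtildeKY x 𝔏 (sectELettersYOfRecordTC x 𝔳 𝔢₀) U * elimCtY x 𝔳 U := by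
  rw [CkY_apply, elimCΛY_sectELettersYOfRecordTC, elimCtΛY_sectELettersYOfRecordTC]

variable {𝔳} in
/-- ★★ **`LocalOuterY` AT THE SEVEN-LETTER RECORD** (the outer letters are FILE (15)'s; norm-one `G`, `G`-valued `V`). [cite: Balaban1985BackgroundPropagators, (3.185) p.432, (3.168)–(3.169) p.430] -/
theorem localOuterY_ofRecordTC [FiniteDimensional ℂ 𝔸] {G : Subgroup 𝔸ˣ} (hG1 : ∀ g ∈ G, ‖((g : 𝔸ˣ) : 𝔸)‖ ≤ 1) (𝔢₀ : SectELettersY 𝔸 x) {U : CfgY 𝔸 x.toKIdx}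
    (h𝔳 : ∀ b, 𝔳 U b ∈ G) :
    LocalOuterY x (sectELettersYOfRecordTC x 𝔳 𝔢₀) ((ℓ : ℝ) + 2) (1 + 4 * (((d + 1) * ℓ : ℕ) : ℝ)) (1 + 4 * (((d + 1) * ℓ : ℕ) : ℝ)) U :=
  localOuterY_ofRecordT hG1 _ h𝔳

end LettersTC

/-! ## §6 Record level: the v6 instance of record — seven Sect. E letters genuine -/

section RecordV6

open scoped Matrix.Norms.L2Operator
open B7Prop2Explicit (unitaryUnits)
open B7Prop2SpecialUnitary (specialUnitaryUnits specialUnitaryUnits_le_unitaryUnits)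
open B9PinMembersKLevelV1 (geo9Y bg9Y)
open B9PinGeometryKLevelV1 (c35Y unitDistY)
open B9Thm315WholeSectERep (DecayMidY t315_opsYOfRecordV4E_of_3185)
open B9Thm315WholeSectERepOn (DecayMidOnY t315_opsYOfRecordV4E_of_3185_on)

variable (N : ℕ) (θ : Stage3Params) (Mstar : ℕ)

/-- ★★ **THE v6 SECT. E LETTERS OF A STAGE 3′(Y) FAMILY**: member by member, `𝔢₀` with the SEVEN letters `Λ̃ ∕ C ∕ C* ∕ μ ∕ D̄ ∕ μ* ∕ D̄*` replaced by the genuine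
ones over the averaged fields of record `V = avYOfRecord x U` (`⟨D̃⁽²⁾, J⟩ ∕ G̃₂` stay parameters). [cite: Balaban1985BackgroundPropagators, (3.157) p.428, (3.168)–(3.169) p.430, (3.185) p.432] -/
def sectEYOfRecordV6 (𝔢₀ : SectEY N θ Mstar) : SectEY N θ Mstar := fun x => sectELettersYOfRecordTC x (avYOfRecord x) (𝔢₀ x)

/-- ★★★ **THE v6 INSTANCE OF RECORD** of Stage 3′(Y): the v4 instance `opsYOfRecordV4E` AT THE v6 SECT. E LETTERS (same binder shape as v4∕v5; every
`opsYOfRecordV4E_…` face applies verbatim, `opsYOfRecordV6E_eq`). [cite: Balaban1985BackgroundPropagators, Thms 3.1–3.15 pp.397–432, (3.157) p.428] -/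
def opsYOfRecordV6E (𝔯 : ResY N θ Mstar) (𝔢₀ : SectEY N θ Mstar) (𝔴 : RWEY N θ Mstar) (𝔈 : ExpsY N θ Mstar) : OpsY N θ Mstar :=
  opsYOfRecordV4E N θ Mstar 𝔯 (sectEYOfRecordV6 N θ Mstar 𝔢₀) 𝔴 𝔈

variable (𝔯 : ResY N θ Mstar) (𝔢₀ : SectEY N θ Mstar) (𝔴 : RWEY N θ Mstar) (𝔈 : ExpsY N θ Mstar)

/-- the v6 instance is the v4 instance at the v6 Sect. E letters. [cite: Balaban1985BackgroundPropagators, (3.157) p.428, bookkeeping] -/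
theorem opsYOfRecordV6E_eq : opsYOfRecordV6E N θ Mstar 𝔯 𝔢₀ 𝔴 𝔈 = opsYOfRecordV4E N θ Mstar 𝔯 (sectEYOfRecordV6 N θ Mstar 𝔢₀) 𝔴 𝔈 := rfl

/-- the v6 Sect. E letters at a member. [cite: Balaban1985BackgroundPropagators, (3.157) p.428, bookkeeping] -/
theorem sectEYOfRecordV6_apply (x : MemberY θ.d₆ θ.ℓ₆ θ.hd' θ.hL' θ.b₀ θ.b₁ Mstar) :
    sectEYOfRecordV6 N θ Mstar 𝔢₀ x = sectELettersYOfRecordTC x (avYOfRecord x) (𝔢₀ x) := rfl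

/-- **the v6 letters ARE the v5 letters of `𝔢₀` with `Λ̃ ∕ C ∕ C*` replaced** — every `sectEYOfRecordV5` face applies to them. [cite: Balaban1985BackgroundPropagators, (3.157) p.428, (3.185) p.432, bookkeeping] -/
theorem sectEYOfRecordV6_eq_sectEYOfRecordV5 : sectEYOfRecordV6 N θ Mstar 𝔢₀ = sectEYOfRecordV5 N θ Mstar (fun x =>
    { 𝔢₀ x with LamT := lamTY x, LamT_inΛ := lamTY_inΛ x, elimC := elimCY x (avYOfRecord x), elimCt := elimCtY x (avYOfRecord x) }) := rfl

/-- the v6 record's seven genuine letters at a member. [cite: Balaban1985BackgroundPropagators, (3.157) p.428, (3.168)–(3.169) p.430, bookkeeping] -/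
theorem sectEYOfRecordV6_letters (x : MemberY θ.d₆ θ.ℓ₆ θ.hd' θ.hL' θ.b₀ θ.b₁ Mstar) :
    (sectEYOfRecordV6 N θ Mstar 𝔢₀ x).LamT = lamTY x ∧ (sectEYOfRecordV6 N θ Mstar 𝔢₀ x).elimC = elimCY x (avYOfRecord x) ∧
      (sectEYOfRecordV6 N θ Mstar 𝔢₀ x).elimCt = elimCtY x (avYOfRecord x) ∧ (sectEYOfRecordV6 N θ Mstar 𝔢₀ x).mu = muY x (avYOfRecord x) ∧
      (sectEYOfRecordV6 N θ Mstar 𝔢₀ x).Dbar = DbarY x (avYOfRecord x) ∧ (sectEYOfRecordV6 N θ Mstar 𝔢₀ x).muT = muTY x (avYOfRecord x) ∧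
      (sectEYOfRecordV6 N θ Mstar 𝔢₀ x).DbarT = DbarTY x (avYOfRecord x) :=
  ⟨rfl, rfl, rfl, rfl, rfl, rfl, rfl⟩

/-- the v6 record keeps `𝔢₀`'s `⟨D̃⁽²⁾, J⟩` and `G̃₂`. [cite: Balaban1985BackgroundPropagators, (3.156) p.428, (3.186) p.432, bookkeeping] -/
theorem sectEYOfRecordV6_params (x : MemberY θ.d₆ θ.ℓ₆ θ.hd' θ.hL' θ.b₀ θ.b₁ Mstar) :
    (sectEYOfRecordV6 N θ Mstar 𝔢₀ x).D2J = (𝔢₀ x).D2J ∧ (sectEYOfRecordV6 N θ Mstar 𝔢₀ x).Gt2 = (𝔢₀ x).Gt2 := ⟨rfl, rfl⟩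

/-- the v6 instance's base letters, `P349` and expansion slot are the v4 instance's (same `𝔯`, `𝔴`, `𝔈`). [cite: Balaban1985BackgroundPropagators, Thms 3.1–3.14 pp.397–427, bookkeeping] -/
theorem opsYOfRecordV6E_letters (x : MemberY θ.d₆ θ.ℓ₆ θ.hd' θ.hL' θ.b₀ θ.b₁ Mstar) :
    (opsYOfRecordV6E N θ Mstar 𝔯 𝔢₀ 𝔴 𝔈 x).P349 = (opsYOfRecordV4E N θ Mstar 𝔯 𝔢₀ 𝔴 𝔈 x).P349 ∧
      (opsYOfRecordV6E N θ Mstar 𝔯 𝔢₀ 𝔴 𝔈 x).HasRWExpC = (opsYOfRecordV4E N θ Mstar 𝔯 𝔢₀ 𝔴 𝔈 x).HasRWExpC :=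
  ⟨rfl, rfl⟩

/-- ★ **`C^{(k)}(Λ; U)` OF THE v6 INSTANCE, UNFOLDED TO THIS FILE'S `C`, `C*`**: `C(V) · C̃^{(k)}(Λ; U) · C(V)*` at `V = avYOfRecord x U`.
[cite: Balaban1985BackgroundPropagators, (3.158) p.428] -/
theorem CkY_sectEYOfRecordV6 (x : MemberY θ.d₆ θ.ℓ₆ θ.hd' θ.hL' θ.b₀ θ.b₁ Mstar) (𝔏 : CovLettersY (Matrix (Fin N) (Fin N) ℂ) x)
    (U : CfgY (Matrix (Fin N) (Fin N) ℂ) x.toKIdx) :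
    CkY x 𝔏 (sectEYOfRecordV6 N θ Mstar 𝔢₀ x) U =
      elimCY x (avYOfRecord x) U * CtildeKY x 𝔏 (sectEYOfRecordV6 N θ Mstar 𝔢₀ x) U * elimCtY x (avYOfRecord x) U :=
  CkY_sectELettersYOfRecordTC x (avYOfRecord x) 𝔏 (𝔢₀ x) U

/-- ★★★ **`LocalOuterY` AT THE v6 RECORD — NO RESIDUAL HYPOTHESIS** (`G ≤ U(N)`, `G`-valued `U`; `r = ℓ + 2`, `m_E = m_F = 1 + 4(d+1)ℓ`).
[cite: Balaban1985BackgroundPropagators, (3.185) p.432, (3.168)–(3.169) p.430] -/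
theorem localOuterY_sectEYOfRecordV6 (x : MemberY θ.d₆ θ.ℓ₆ θ.hd' θ.hL' θ.b₀ θ.b₁ Mstar)
    {G : Subgroup (Matrix (Fin N) (Fin N) ℂ)ˣ} (hG : G ≤ unitaryUnits (Matrix (Fin N) (Fin N) ℂ))
    {U : CfgY (Matrix (Fin N) (Fin N) ℂ) x.toKIdx} (hU : ∀ μ z, U μ z ∈ G) :
    LocalOuterY x (sectEYOfRecordV6 N θ Mstar 𝔢₀ x) ((θ.ℓ₆ : ℝ) + 2) (1 + 4 * (((θ.d₆ + 1) * θ.ℓ₆ : ℕ) : ℝ))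
      (1 + 4 * (((θ.d₆ + 1) * θ.ℓ₆ : ℕ) : ℝ)) U :=
  localOuterY_ofRecordTC x (norm_coe_le_one_of_le_unitaryUnits hG) (𝔢₀ x) (fun b => avYOfRecord_mem x hU b)

/-- ★ **the v6 record's `C ∕ C*` are trace-transposes of each other** (all pivot coefficients and their transposes units). [cite: Balaban1985BackgroundPropagators, (3.157) p.428, (3.9) p.391] -/
theorem sum_trace_elimC_elimCt_sectEYOfRecordV6 (x : MemberY θ.d₆ θ.ℓ₆ θ.hd' θ.hL' θ.b₀ θ.b₁ Mstar) (U : CfgY (Matrix (Fin N) (Fin N) ℂ) x.toKIdx)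
    (hK : ∀ c : CBondY x, IsUnit (KY x (avYOfRecord x) U c)) (hKT : ∀ c : CBondY x, IsUnit (KTY x (avYOfRecord x) U c))
    (B A : IBondY x.toKIdx → Matrix (Fin N) (Fin N) ℂ) :
    ∑ q, Matrix.trace ((sectEYOfRecordV6 N θ Mstar 𝔢₀ x).elimC U B q * A q) =
      ∑ q, Matrix.trace (B q * (sectEYOfRecordV6 N θ Mstar 𝔢₀ x).elimCt U A q) :=
  sum_tr_elimCY_mul x (avYOfRecord x) (Matrix.traceLinearMap (Fin N) ℂ ℂ) (fun a b => Matrix.trace_mul_comm a b) U hK hKT B A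

/-- the v6 record's `μ ∕ μ*` are trace-transposes of each other. [cite: Balaban1985BackgroundPropagators, (3.9) p.391, (3.185) p.432] -/
theorem sum_trace_mu_muT_sectEYOfRecordV6 (x : MemberY θ.d₆ θ.ℓ₆ θ.hd' θ.hL' θ.b₀ θ.b₁ Mstar) (U : CfgY (Matrix (Fin N) (Fin N) ℂ) x.toKIdx)
    (B : IBondY x.toKIdx → Matrix (Fin N) (Fin N) ℂ) (f : SiteY x.toKIdx → Matrix (Fin N) (Fin N) ℂ) :
    ∑ z, Matrix.trace ((sectEYOfRecordV6 N θ Mstar 𝔢₀ x).mu U B z * f z) = ∑ q, Matrix.trace (B q * (sectEYOfRecordV6 N θ Mstar 𝔢₀ x).muT U f q) :=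
  sum_trace_muY_mul U B f

/-- the v6 record's `D̄ ∕ D̄*` are trace-transposes of each other. [cite: Balaban1985BackgroundPropagators, (3.9) p.391, (3.185) p.432] -/
theorem sum_trace_Dbar_DbarT_sectEYOfRecordV6 (x : MemberY θ.d₆ θ.ℓ₆ θ.hd' θ.hL' θ.b₀ θ.b₁ Mstar) (U : CfgY (Matrix (Fin N) (Fin N) ℂ) x.toKIdx)
    (f : SiteY x.toKIdx → Matrix (Fin N) (Fin N) ℂ) (Al : IBondY x.toKIdx → Matrix (Fin N) (Fin N) ℂ) :
    ∑ q, Matrix.trace ((sectEYOfRecordV6 N θ Mstar 𝔢₀ x).Dbar U f q * Al q) = ∑ z, Matrix.trace (f z * (sectEYOfRecordV6 N θ Mstar 𝔢₀ x).DbarT U Al z) :=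
  sum_trace_DbarY_mul U f Al

/-- ★★★ **ROW 24 (`t315`) AT THE v6 INSTANCE OF RECORD THROUGH THE (3.185) SLOT — THREE DISPLAYED CONJUNCTS** (the (3.185) identity at the v6 letters, the
expansion slot (3.186), the middle-factor decay; `LocalOuterY` of both outer factors PROVED). [cite: Balaban1985BackgroundPropagators, Thm 3.15 (3.185)–(3.187) p.432, (3.157) p.428, (3.168)–(3.169) p.430] -/
theorem t315_opsYOfRecordV6E_of_3185 {a₀ δ₁ B₁ : ℝ} (ha₀ : 0 < a₀) (hδ₁ : 0 < δ₁) (hB₁ : 0 < B₁)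
    (h : ∀ (x : MemberY θ.d₆ θ.ℓ₆ θ.hd' θ.hL' θ.b₀ θ.b₁ Mstar) (α₀ : ℝ), 0 < α₀ → (geo9Y x).M * α₀ ≤ a₀ →
      ∀ U : (bg9Y (Matrix (Fin N) (Fin N) ℂ) (specialUnitaryUnits (Fin N)) x).Cfg,
        (bg9Y (Matrix (Fin N) (Fin N) ℂ) (specialUnitaryUnits (Fin N)) x).Reg335 c35Y α₀ U →
        (bg9Y (Matrix (Fin N) (Fin N) ℂ) (specialUnitaryUnits (Fin N)) x).Reg336 c35Y α₀ U →
          givenBy3185Y x (lettersYOfRecordV4 N θ Mstar 𝔯 x) (sectEYOfRecordV6 N θ Mstar 𝔢₀ x) U ∧ hasRWExpCY (𝔴 x) U δ₁ ∧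
            DecayMidY x (lettersYOfRecordV4 N θ Mstar 𝔯 x) (sectEYOfRecordV6 N θ Mstar 𝔢₀ x) B₁ U δ₁) :
    B9.Thm315FullPrinted c35Y geo9Y (bg9Y (Matrix (Fin N) (Fin N) ℂ) (specialUnitaryUnits (Fin N)))
      (fun x => (opsYOfRecordV6E N θ Mstar 𝔯 𝔢₀ 𝔴 𝔈 x).Ck) inΛY unitDistY
      (fun x => (opsYOfRecordV6E N θ Mstar 𝔯 𝔢₀ 𝔴 𝔈 x).GivenBy3185) (fun x => (opsYOfRecordV6E N θ Mstar 𝔯 𝔢₀ 𝔴 𝔈 x).HasRWExpC) := by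
  have hmE : (0 : ℝ) < 1 + 4 * (((θ.d₆ + 1) * θ.ℓ₆ : ℕ) : ℝ) := by positivity
  refine t315_opsYOfRecordV4E_of_3185 N θ Mstar 𝔯 (sectEYOfRecordV6 N θ Mstar 𝔢₀) 𝔴 𝔈 (r := (θ.ℓ₆ : ℝ) + 2) ha₀ hδ₁ hB₁ hmE hmE
    fun x α₀ hα hMa U hU hU' => ?_
  obtain ⟨h85, hRW, hS⟩ := h x α₀ hα hMa U hU hU'
  exact ⟨h85, hRW, localOuterY_sectEYOfRecordV6 N θ Mstar 𝔢₀ x specialUnitaryUnits_le_unitaryUnits hU.1.1, hS⟩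

/-- ★★★ **THE SAME ON `B9Thm315WholeSectERepOn`** (middle decay asked between Λ-bonds only). [cite: Balaban1985BackgroundPropagators, Thm 3.15 (3.185)–(3.187) p.432, (3.157) p.428, (3.186) p.432] -/
theorem t315_opsYOfRecordV6E_of_3185_on {a₀ δ₁ B₁ : ℝ} (ha₀ : 0 < a₀) (hδ₁ : 0 < δ₁) (hB₁ : 0 < B₁)
    (h : ∀ (x : MemberY θ.d₆ θ.ℓ₆ θ.hd' θ.hL' θ.b₀ θ.b₁ Mstar) (α₀ : ℝ), 0 < α₀ → (geo9Y x).M * α₀ ≤ a₀ →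
      ∀ U : (bg9Y (Matrix (Fin N) (Fin N) ℂ) (specialUnitaryUnits (Fin N)) x).Cfg,
        (bg9Y (Matrix (Fin N) (Fin N) ℂ) (specialUnitaryUnits (Fin N)) x).Reg335 c35Y α₀ U →
        (bg9Y (Matrix (Fin N) (Fin N) ℂ) (specialUnitaryUnits (Fin N)) x).Reg336 c35Y α₀ U →
          givenBy3185Y x (lettersYOfRecordV4 N θ Mstar 𝔯 x) (sectEYOfRecordV6 N θ Mstar 𝔢₀ x) U ∧ hasRWExpCY (𝔴 x) U δ₁ ∧
            DecayMidOnY x (lettersYOfRecordV4 N θ Mstar 𝔯 x) (sectEYOfRecordV6 N θ Mstar 𝔢₀ x) B₁ U δ₁) :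
    B9.Thm315FullPrinted c35Y geo9Y (bg9Y (Matrix (Fin N) (Fin N) ℂ) (specialUnitaryUnits (Fin N)))
      (fun x => (opsYOfRecordV6E N θ Mstar 𝔯 𝔢₀ 𝔴 𝔈 x).Ck) inΛY unitDistY
      (fun x => (opsYOfRecordV6E N θ Mstar 𝔯 𝔢₀ 𝔴 𝔈 x).GivenBy3185) (fun x => (opsYOfRecordV6E N θ Mstar 𝔯 𝔢₀ 𝔴 𝔈 x).HasRWExpC) := by
  have hmE : (0 : ℝ) < 1 + 4 * (((θ.d₆ + 1) * θ.ℓ₆ : ℕ) : ℝ) := by positivity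
  refine t315_opsYOfRecordV4E_of_3185_on N θ Mstar 𝔯 (sectEYOfRecordV6 N θ Mstar 𝔢₀) 𝔴 𝔈 (r := (θ.ℓ₆ : ℝ) + 2) ha₀ hδ₁ hB₁ hmE hmE
    fun x α₀ hα hMa U hU hU' => ?_
  obtain ⟨h85, hRW, hS⟩ := h x α₀ hα hMa U hU hU'
  exact ⟨h85, hRW, localOuterY_sectEYOfRecordV6 N θ Mstar 𝔢₀ x specialUnitaryUnits_le_unitaryUnits hU.1.1, hS⟩

end RecordV6

end Literature.MathematicalPhysics.QuantumFieldTheory.Balaban1983to89.Node00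

end
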